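import Literature.Analysis.FunctionSpaces.BMOCarlesonDuality
import Mathlib.MeasureTheory.Integral.MeanInequalities
import Mathlib.Analysis.SpecialFunctions.Gaussian.GaussianIntegral
import HarnessLib

/-!
# Koch–Tataru's converse, I: caloric extensions of tempered functions and the pairing with atoms

Topic `Analysis/FunctionSpaces`; fifth file of the Koch–Tataru cluster
(`BMOCarleson.lean`: decomposition of `Literature.Analysis.FunctionSpaces.memBMOInv_iff_carleson_heat` (Koch–Tataru 2001,
Theorem 1) into the named facts (A)–(E); `BMOCarlesonProofs.lean`: (A), (C);
`BMOCarlesonFeffermanStein.lean`: (B) from John–Nirenberg; `BMOCarlesonDuality.lean`: (E)).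
This file and its sequel `BMOCarlesonPotential.lean` **prove the converse direction of
Koch–Tataru's Theorem 1** (`Carleson ⇒ BMO⁻¹`), following Koch–Tataru's proof (p. 10–11:
`fⁱ = ∂ᵢΔ⁻¹u`, formally `∇Δ⁻¹u = -∫₀^∞ ∇e^{sΔ}u ds`) with their Lemma 4.1 (Fourier multipliers on
`BMO⁻¹`) replaced by a hand-made potential. This first part supplies:

* `§ Tempered`: caloric extensions of tempered functions (growth `(1 + ‖y‖)^{-K} u ∈ L¹`), the
  semigroup laws `e^{(s+τ)Δ}u = e^{τΔ}e^{sΔ}u` and `∇e^{(s+τ)Δ}u = ∇K_τ ∗ e^{sΔ}u`.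
* `§ Pointwise`: **Koch–Tataru's pointwise bound (22)** `|e^{tΔ}u|² ≤ C γ / t`
  (`exists_sq_heatExtension_le`: `e^{tΔ}u = e^{(t-σ)Δ}e^{σΔ}u` averaged over `σ ∈ (t/4, t/2)`,
  Cauchy–Schwarz, dyadic shells and Carleson boxes), with its consequences
  `‖∇e^{tΔ}u‖ ≤ C γ^{1/2}/t` and the Lipschitz bound
  `‖∇e^{sΔ}u (x) - ∇e^{sΔ}u (x')‖ ≤ C γ^{1/2} ‖x - x'‖ s^{-3/2}`.
* `§ Pairing`: for an atom-like `g` (bounded, supported in a ball),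
  `∫ g ⟪∫_ε^T ∇e^{sΔ}u ds, v⟫ = -2 ∫∫_{(ε/2,T/2) × E} e^{tΔ}u ⟪∇e^{tΔ}g, v⟫` (Fubini, oddness of `∇K`,
  `e^{bΔ}∇e^{aΔ} = ∇e^{(a+b)Δ}`).
* `§ Total`: the tent/annuli estimate of `BMOCarlesonDuality.lean` for an abstract Carleson
  density (here `|e^{tΔ}u|`), and the **small-time estimate**
  `∫∫_{(0,a) × E} |e^{tΔ}u| ‖∇e^{tΔ}g‖ ≤ ((∫∫_{(0,a)×B(x₀,2ρ)} |e^{tΔ}u|²)^{1/2} + C √a ρ^{d/2-1} γ^{1/2}) ‖g‖₂`.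

Only theorems are declared (no new definitions).

## References

* H. Koch, D. Tataru, *Well-posedness for the Navier–Stokes equations*, Adv. Math. 157 (2001),
  Definition 1.1, Theorem 1 and its proof (§4, (22), Lemma 4.1).
* E. M. Stein, *Harmonic Analysis* (1993), Chapter IV, §4.3–4.4.
-/

noncomputable section

open MeasureTheory Metric Filter Topology
open scoped ENNReal NNReal RealInnerProductSpace Convolution

namespace Literature.Analysis.FunctionSpaces

namespace BMOInv


/-! ## Tempered functions and their caloric extensions -/

section Tempered

variable {E : Type*} [NormedAddCommGroup E] [InnerProductSpace ℝ E] [FiniteDimensional ℝ E]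
  [MeasurableSpace E] [BorelSpace E]

/-- Koch–Tataru's temperedness hypothesis `(1 + ‖y‖²)^{-N} u ∈ L¹` in the growth form
`(1 + ‖y‖)^{-2N} u ∈ L¹` used throughout this file. [folklore] -/
theorem integrable_growth_of_tempered {u : E → ℝ} {N : ℕ}
    (hu : Integrable fun y => ((1 + ‖y‖ ^ 2) ^ N)⁻¹ * u y) :
    Integrable fun y => ((1 + ‖y‖) ^ (2 * N))⁻¹ * u y := by
  have hmeas : AEStronglyMeasurable u volume := by
    have h1 : AEStronglyMeasurable
        (fun y => (1 + ‖y‖ ^ 2) ^ N * (((1 + ‖y‖ ^ 2) ^ N)⁻¹ * u y)) volume :=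
      (Continuous.aestronglyMeasurable (by fun_prop)).mul hu.1
    refine h1.congr (Eventually.of_forall fun y => ?_)
    have : (1 + ‖y‖ ^ 2) ^ N ≠ 0 := by positivity
    simp only
    rw [← mul_assoc, mul_inv_cancel₀ this, one_mul]
  have hwc : Continuous fun y : E => ((1 + ‖y‖) ^ (2 * N))⁻¹ :=
    Continuous.inv₀ (by fun_prop) (fun y => by positivity)
  refine hu.mono (hwc.aestronglyMeasurable.mul hmeas) (Eventually.of_forall fun y => ?_)
  rw [norm_mul, norm_mul, norm_inv, norm_inv,
    Real.norm_of_nonneg (show (0 : ℝ) ≤ (1 + ‖y‖) ^ (2 * N) by positivity),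
    Real.norm_of_nonneg (show (0 : ℝ) ≤ (1 + ‖y‖ ^ 2) ^ N by positivity)]
  refine mul_le_mul_of_nonneg_right ?_ (norm_nonneg _)
  refine inv_anti₀ (by positivity) ?_
  rw [pow_mul]
  exact pow_le_pow_left₀ (by positivity) (by nlinarith [norm_nonneg y]) N

omit [InnerProductSpace ℝ E] [FiniteDimensional ℝ E] [MeasurableSpace E] [BorelSpace E] in
/-- Peetre's inequality in the form `(1 + ‖z‖)^K ≤ (1 + ‖y‖)^K (1 + ‖y - z‖)^K`. [folklore] -/
theorem one_add_norm_pow_le_mul_pow [NormedSpace ℝ E] (y z : E) (K : ℕ) :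
    (1 + ‖z‖) ^ K ≤ (1 + ‖y‖) ^ K * (1 + ‖y - z‖) ^ K := by
  rw [← mul_pow]
  refine pow_le_pow_left₀ (by positivity) ?_ K
  have h := one_add_norm_sub_le_mul z y (0 : E)
  simp only [sub_zero] at h
  rwa [norm_sub_rev z y, mul_comm] at h

omit [FiniteDimensional ℝ E] in
/-- Joint measurability of `(t, x) ↦ K_t(x)`. [folklore] -/
theorem measurable_heatKernel_uncurry :
    Measurable (fun p : ℝ × E => heatKernel p.1 p.2) := by
  unfold heatKernel
  fun_prop

/-- Joint measurability of `(t, y) ↦ e^{tΔ} u (y)` for a.e.-strongly measurable `u`. [folklore] -/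
theorem measurable_heatExtension {u : E → ℝ} (hu : AEStronglyMeasurable u volume) :
    Measurable (fun p : ℝ × E => heatExtension u p.1 p.2) := by
  obtain ⟨g, hg, hug⟩ := hu
  have heq : (fun p : ℝ × E => heatExtension u p.1 p.2) =
      fun p : ℝ × E => ∫ z, heatKernel p.1 (p.2 - z) * g z := by
    funext p
    refine integral_congr_ae ?_
    filter_upwards [hug] with z hz
    rw [hz]
  rw [heq]
  refine (StronglyMeasurable.integral_prod_right'
    (f := fun q : (ℝ × E) × E => heatKernel q.1.1 (q.1.2 - q.2) * g q.2) ?_).measurable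
  refine StronglyMeasurable.mul ?_ (hg.comp_measurable measurable_snd)
  have h2 : Measurable (fun q : (ℝ × E) × E => (q.1.1, q.1.2 - q.2)) := by fun_prop
  exact (measurable_heatKernel_uncurry.comp h2).stronglyMeasurable

/-- `u K_t(y - ·) ∈ L¹` for `u` of polynomial growth and `t > 0`. [folklore] -/
theorem integrable_mul_heatKernel_of_growth {u : E → ℝ} {K : ℕ}
    (hfw : Integrable fun w => ((1 + ‖w‖) ^ K)⁻¹ * u w) {t : ℝ} (ht : 0 < t) (y : E) :
    Integrable fun z => u z * heatKernel t (y - z) := by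
  obtain ⟨C, hC⟩ := exists_bound_one_add_norm_pow_mul_heatKernel ht y K
  exact integrable_mul_of_weight_bound (fun z => by positivity) (by fun_prop) hfw
    (continuous_heatKernel_sub t y)
    (fun z => show 0 ≤ heatKernel t (y - z) from (Literature.Analysis.UnboundedOperators.heatKernel_pos ht _).le) hC

/-- `heatKernel t (y - ·) * u ∈ L¹` (the integrand of `heatExtension u t y`) for `u` of polynomial
growth and `t > 0`. [folklore] -/
theorem integrable_heatKernel_mul_of_growth {u : E → ℝ} {K : ℕ}
    (hfw : Integrable fun w => ((1 + ‖w‖) ^ K)⁻¹ * u w) {t : ℝ} (ht : 0 < t) (y : E) :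
    Integrable fun z => heatKernel t (y - z) * u z := by
  refine (integrable_mul_heatKernel_of_growth hfw ht y).congr (Eventually.of_forall fun z => ?_)
  exact mul_comm _ _

/-- `u ∇K_t(y - ·) ∈ L¹` for `u` of polynomial growth and `t > 0`. [folklore] -/
theorem integrable_smul_heatKernelGrad_of_growth {u : E → ℝ} {K : ℕ}
    (hfw : Integrable fun w => ((1 + ‖w‖) ^ K)⁻¹ * u w) {t : ℝ} (ht : 0 < t) (y : E) :
    Integrable fun z => u z • heatKernelGrad t (y - z) := by
  obtain ⟨C, hC⟩ := exists_bound_one_add_norm_pow_mul_norm_heatKernelGrad ht y K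
  have hint : Integrable fun z => u z * ‖heatKernelGrad t (y - z)‖ :=
    integrable_mul_of_weight_bound (w := fun z => (1 + ‖z‖) ^ K)
      (fun z => by positivity) (by fun_prop) hfw
      ((continuous_heatKernelGrad t).comp (continuous_const.sub continuous_id)).norm
      (fun z => norm_nonneg _) hC
  have hKm : AEStronglyMeasurable (fun z : E => heatKernelGrad t (y - z)) volume :=
    ((continuous_heatKernelGrad t).comp (continuous_const.sub continuous_id)).aestronglyMeasurable
  refine hint.norm.mono' ((aestronglyMeasurable_of_growth hfw).smul hKm)
    (Eventually.of_forall fun z => ?_)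
  rw [norm_smul, Real.norm_eq_abs, Real.norm_eq_abs, abs_mul, abs_of_nonneg (norm_nonneg _)]

/-- **Polynomial growth of the caloric extension of a tempered function, uniformly on compact time
intervals**: `|e^{tΔ}u (y)| ≤ C (1 + ‖y‖)^K` for `t ∈ [t₁, t₂]`, `0 < t₁`. [folklore] -/
theorem exists_unif_bound_heatExtension {u : E → ℝ} {K : ℕ}
    (hfw : Integrable fun w => ((1 + ‖w‖) ^ K)⁻¹ * u w) {t₁ t₂ : ℝ} (ht₁ : 0 < t₁) (h12 : t₁ ≤ t₂) :
    ∃ C : ℝ, 0 ≤ C ∧ ∀ t ∈ Set.Icc t₁ t₂, ∀ y : E,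
      |heatExtension u t y| ≤ C * (1 + ‖y‖) ^ K := by
  obtain ⟨C, hC0, hC⟩ := exists_unif_bound_heatKernel (E := E) K ht₁ h12
  obtain ⟨I, hI⟩ : ∃ I : ℝ, I = ∫ w, ‖((1 + ‖w‖) ^ K)⁻¹ * u w‖ := ⟨_, rfl⟩
  have hI0 : 0 ≤ I := hI ▸ integral_nonneg fun w => norm_nonneg _
  refine ⟨C * I, by positivity, fun t ht y => ?_⟩
  have ht0 : 0 < t := ht₁.trans_le ht.1
  have hbound : ∀ z, ‖heatKernel t (y - z) * u z‖ ≤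
      C * (1 + ‖y‖) ^ K * ‖((1 + ‖z‖) ^ K)⁻¹ * u z‖ := by
    intro z
    have hKz : 0 < (1 + ‖z‖) ^ K := by positivity
    have hk : 0 ≤ heatKernel t (y - z) := (Literature.Analysis.UnboundedOperators.heatKernel_pos ht0 _).le
    have h1 : (1 + ‖z‖) ^ K * heatKernel t (y - z) ≤ (1 + ‖y‖) ^ K * C := by
      calc (1 + ‖z‖) ^ K * heatKernel t (y - z)
          ≤ (1 + ‖y‖) ^ K * (1 + ‖y - z‖) ^ K * heatKernel t (y - z) := by
            gcongr
            exact one_add_norm_pow_le_mul_pow y z K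
        _ = (1 + ‖y‖) ^ K * ((1 + ‖y - z‖) ^ K * heatKernel t (y - z)) := by ring
        _ ≤ (1 + ‖y‖) ^ K * C := by gcongr; exact hC t ht (y - z)
    have h2 : (1 + ‖z‖) ^ K * heatKernel t (y - z) * (((1 + ‖z‖) ^ K)⁻¹ * ‖u z‖) =
        heatKernel t (y - z) * ‖u z‖ := by
      rw [mul_mul_mul_comm, mul_inv_cancel₀ hKz.ne', one_mul]
    rw [norm_mul, norm_mul, norm_inv, Real.norm_of_nonneg hk, Real.norm_of_nonneg hKz.le, ← h2]
    calc (1 + ‖z‖) ^ K * heatKernel t (y - z) * (((1 + ‖z‖) ^ K)⁻¹ * ‖u z‖)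
        ≤ ((1 + ‖y‖) ^ K * C) * (((1 + ‖z‖) ^ K)⁻¹ * ‖u z‖) := by gcongr
      _ = C * (1 + ‖y‖) ^ K * (((1 + ‖z‖) ^ K)⁻¹ * ‖u z‖) := by ring
  calc |heatExtension u t y| = ‖∫ z, heatKernel t (y - z) * u z‖ := rfl
    _ ≤ ∫ z, C * (1 + ‖y‖) ^ K * ‖((1 + ‖z‖) ^ K)⁻¹ * u z‖ :=
        norm_integral_le_of_norm_le (hfw.norm.const_mul _) (Eventually.of_forall hbound)
    _ = C * (1 + ‖y‖) ^ K * I := by rw [integral_const_mul, hI]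
    _ = C * I * (1 + ‖y‖) ^ K := by ring

/-- Polynomial growth of `∇e^{tΔ}u` for tempered `u`, uniformly on compact time intervals:
`‖∇e^{tΔ}u (y)‖ ≤ C (1 + ‖y‖)^K` for `t ∈ [t₁, t₂]`, `0 < t₁`. [folklore] -/
theorem exists_unif_bound_heatExtensionGrad_of_growth {u : E → ℝ} {K : ℕ}
    (hfw : Integrable fun w => ((1 + ‖w‖) ^ K)⁻¹ * u w) {t₁ t₂ : ℝ} (ht₁ : 0 < t₁) (h12 : t₁ ≤ t₂) :
    ∃ C : ℝ, 0 ≤ C ∧ ∀ t ∈ Set.Icc t₁ t₂, ∀ y : E,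
      ‖heatExtensionGrad u t y‖ ≤ C * (1 + ‖y‖) ^ K := by
  obtain ⟨C, hC0, hC⟩ := exists_unif_bound_heatKernelGrad (E := E) K ht₁ h12
  obtain ⟨I, hI⟩ : ∃ I : ℝ, I = ∫ w, ‖((1 + ‖w‖) ^ K)⁻¹ * u w‖ := ⟨_, rfl⟩
  have hI0 : 0 ≤ I := hI ▸ integral_nonneg fun w => norm_nonneg _
  refine ⟨C * I, by positivity, fun t ht y => ?_⟩
  have hbound : ∀ z, ‖u z • heatKernelGrad t (y - z)‖ ≤
      C * (1 + ‖y‖) ^ K * ‖((1 + ‖z‖) ^ K)⁻¹ * u z‖ := by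
    intro z
    have hKz : 0 < (1 + ‖z‖) ^ K := by positivity
    have h1 : (1 + ‖z‖) ^ K * ‖heatKernelGrad t (y - z)‖ ≤ (1 + ‖y‖) ^ K * C := by
      calc (1 + ‖z‖) ^ K * ‖heatKernelGrad t (y - z)‖
          ≤ (1 + ‖y‖) ^ K * (1 + ‖y - z‖) ^ K * ‖heatKernelGrad t (y - z)‖ := by
            gcongr
            exact one_add_norm_pow_le_mul_pow y z K
        _ = (1 + ‖y‖) ^ K * ((1 + ‖y - z‖) ^ K * ‖heatKernelGrad t (y - z)‖) := by ring
        _ ≤ (1 + ‖y‖) ^ K * C := by gcongr; exact hC t ht (y - z)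
    have h2 : (1 + ‖z‖) ^ K * ‖heatKernelGrad t (y - z)‖ * (((1 + ‖z‖) ^ K)⁻¹ * ‖u z‖) =
        ‖heatKernelGrad t (y - z)‖ * ‖u z‖ := by
      rw [mul_mul_mul_comm, mul_inv_cancel₀ hKz.ne', one_mul]
    rw [norm_smul, norm_mul, norm_inv, Real.norm_of_nonneg hKz.le, mul_comm ‖u z‖, ← h2]
    calc (1 + ‖z‖) ^ K * ‖heatKernelGrad t (y - z)‖ * (((1 + ‖z‖) ^ K)⁻¹ * ‖u z‖)
        ≤ ((1 + ‖y‖) ^ K * C) * (((1 + ‖z‖) ^ K)⁻¹ * ‖u z‖) := by gcongr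
      _ = C * (1 + ‖y‖) ^ K * (((1 + ‖z‖) ^ K)⁻¹ * ‖u z‖) := by ring
  calc ‖heatExtensionGrad u t y‖ = ‖∫ z, u z • heatKernelGrad t (y - z)‖ := rfl
    _ ≤ ∫ z, C * (1 + ‖y‖) ^ K * ‖((1 + ‖z‖) ^ K)⁻¹ * u z‖ :=
        norm_integral_le_of_norm_le (hfw.norm.const_mul _) (Eventually.of_forall hbound)
    _ = C * (1 + ‖y‖) ^ K * I := by rw [integral_const_mul, hI]
    _ = C * I * (1 + ‖y‖) ^ K := by ring


omit [FiniteDimensional ℝ E] [MeasurableSpace E] [BorelSpace E] in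
/-- The heat kernel is even: `K_t(x - y) = K_t(y - x)`. [folklore] -/
theorem heatKernel_sub_comm (t : ℝ) (x y : E) : heatKernel t (x - y) = heatKernel t (y - x) := by
  unfold heatKernel
  rw [norm_sub_rev]

/-- Growth hypothesis for `|u|`. [folklore] -/
theorem integrable_growth_abs {u : E → ℝ} {K : ℕ}
    (hfw : Integrable fun w => ((1 + ‖w‖) ^ K)⁻¹ * u w) :
    Integrable fun w => ((1 + ‖w‖) ^ K)⁻¹ * |u w| := by
  refine hfw.norm.congr (Eventually.of_forall fun w => ?_)
  simp only [norm_mul, norm_inv, Real.norm_eq_abs]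
  rw [abs_of_pos (show (0 : ℝ) < (1 + ‖w‖) ^ K by positivity)]

/-- The kernel semigroup in integral form: `∫ K_τ(y - w) K_s(w - z) dw = K_{s+τ}(y - z)`. [folklore] -/
theorem integral_heatKernel_mul_heatKernel {s τ : ℝ} (hs : 0 < s) (hτ : 0 < τ) (y z : E) :
    ∫ w, heatKernel τ (y - w) * heatKernel s (w - z) = heatKernel (s + τ) (y - z) := by
  have h := Literature.Analysis.UnboundedOperators.heatKernel_convolution_heatKernel_holds (E := E) hτ hs
  have h2 : ∫ w', Literature.Analysis.UnboundedOperators.heatKernel τ w' * Literature.Analysis.UnboundedOperators.heatKernel s ((y - z) - w') =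
      Literature.Analysis.UnboundedOperators.heatKernel (τ + s) (y - z) := by
    have := congrFun h (y - z)
    rw [convolution_def] at this
    simpa only [ContinuousLinearMap.lsmul_apply, smul_eq_mul] using this
  change ∫ w, Literature.Analysis.UnboundedOperators.heatKernel τ (y - w) * Literature.Analysis.UnboundedOperators.heatKernel s (w - z) = Literature.Analysis.UnboundedOperators.heatKernel (s + τ) (y - z)
  have h3 : ∫ w, Literature.Analysis.UnboundedOperators.heatKernel τ (y - w) * Literature.Analysis.UnboundedOperators.heatKernel s (w - z) =
      ∫ w, (fun w' => Literature.Analysis.UnboundedOperators.heatKernel τ w' * Literature.Analysis.UnboundedOperators.heatKernel s ((y - z) - w')) (y - w) := by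
    refine integral_congr_ae (Eventually.of_forall fun w => ?_)
    simp only
    congr 2
    abel
  rw [h3, integral_sub_left_eq_self
    (fun w' => Literature.Analysis.UnboundedOperators.heatKernel τ w' * Literature.Analysis.UnboundedOperators.heatKernel s ((y - z) - w')) volume y, add_comm s τ]
  exact h2

/-- The gradient-kernel semigroup in integral form:
`∫ K_s(w - z) ∇K_τ(y - w) dw = ∇K_{s+τ}(y - z)`. [folklore] -/
theorem integral_heatKernel_smul_heatKernelGrad {s τ : ℝ} (hs : 0 < s) (hτ : 0 < τ) (y z : E) :
    ∫ w, heatKernel s (w - z) • heatKernelGrad τ (y - w) = heatKernelGrad (s + τ) (y - z) := by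
  have h := heatKernelGrad_add_eq_integral (E := E) hτ hs (y - z)
  have h3 : ∫ w, heatKernel s (w - z) • heatKernelGrad τ (y - w) =
      ∫ w, (fun y' => heatKernel s y' • heatKernelGrad τ ((y - z) - y')) (w - z) := by
    refine integral_congr_ae (Eventually.of_forall fun w => ?_)
    simp only
    congr 2
    abel
  rw [h3, integral_sub_right_eq_self (μ := volume)
    (fun y' => heatKernel s y' • heatKernelGrad τ ((y - z) - y')) z, add_comm s τ, h]

omit [FiniteDimensional ℝ E] [MeasurableSpace E] [BorelSpace E] in
/-- `‖∇K_τ(x)‖ ≤ A_τ K_{2τ}(x)` with `A_τ = 2^{d/2} τ^{-1/2}`: the gradient kernel is dominated by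
the kernel at doubled time. [folklore] -/
theorem norm_heatKernelGrad_le_mul_heatKernel_two_mul {τ : ℝ} (hτ : 0 < τ) (x : E) :
    ‖heatKernelGrad τ x‖ ≤
      (2 : ℝ) ^ ((Module.finrank ℝ E : ℝ) / 2) * (Real.sqrt τ)⁻¹ * heatKernel (2 * τ) x := by
  rw [norm_heatKernelGrad hτ]
  set d : ℕ := Module.finrank ℝ E with hd
  have hK1 : heatKernel τ x = (4 * Real.pi * τ) ^ (-(d : ℝ) / 2) * Real.exp (-‖x‖ ^ 2 / (4 * τ)) := rfl
  have hK2 : heatKernel (2 * τ) x =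
      (4 * Real.pi * (2 * τ)) ^ (-(d : ℝ) / 2) * Real.exp (-‖x‖ ^ 2 / (4 * (2 * τ))) := rfl
  -- `r e^{-r²/(8τ)} ≤ 2 √τ`
  have hr : ‖x‖ * Real.exp (-‖x‖ ^ 2 / (8 * τ)) ≤ 2 * Real.sqrt τ := by
    have hsq : Real.sqrt τ ^ 2 = τ := Real.sq_sqrt hτ.le
    have hst : 0 < Real.sqrt τ := Real.sqrt_pos.mpr hτ
    -- with ρ = ‖x‖ / (2√τ): ρ e^{-ρ²/2} ≤ 1, since e^{ρ²/2} ≥ 1 + ρ²/2 ≥ ρ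
    set ρ : ℝ := ‖x‖ / (2 * Real.sqrt τ) with hρ
    have hρ0 : 0 ≤ ρ := by positivity
    have hxρ : ‖x‖ = 2 * Real.sqrt τ * ρ := by rw [hρ]; field_simp
    have hexp : -‖x‖ ^ 2 / (8 * τ) = -(ρ ^ 2 / 2) := by
      rw [hρ, div_pow, mul_pow, hsq]
      field_simp
      ring
    rw [hexp, hxρ]
    have h1 : ρ ≤ Real.exp (ρ ^ 2 / 2) := by
      have := Real.add_one_le_exp (ρ ^ 2 / 2)
      nlinarith [sq_nonneg (ρ - 1)]
    have h2 : ρ * Real.exp (-(ρ ^ 2 / 2)) ≤ 1 := by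
      rw [Real.exp_neg, ← div_eq_mul_inv, div_le_one (Real.exp_pos _)]
      exact h1
    calc 2 * Real.sqrt τ * ρ * Real.exp (-(ρ ^ 2 / 2)) = 2 * Real.sqrt τ * (ρ * Real.exp (-(ρ ^ 2 / 2))) := by
          ring
      _ ≤ 2 * Real.sqrt τ * 1 := by gcongr
      _ = 2 * Real.sqrt τ := mul_one _
  -- compare the normalisations: (4πτ)^{-d/2} = 2^{d/2} (8πτ)^{-d/2}
  have hnorm : (4 * Real.pi * τ) ^ (-(d : ℝ) / 2) =
      (2 : ℝ) ^ ((d : ℝ) / 2) * (4 * Real.pi * (2 * τ)) ^ (-(d : ℝ) / 2) := by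
    have h8 : (4 * Real.pi * (2 * τ)) = 2 * (4 * Real.pi * τ) := by ring
    rw [h8, Real.mul_rpow (x := 2) (y := 4 * Real.pi * τ) (by norm_num) (by positivity), ← mul_assoc,
      ← Real.rpow_add (by norm_num : (0 : ℝ) < 2)]
    have : (d : ℝ) / 2 + -(d : ℝ) / 2 = 0 := by ring
    rw [this, Real.rpow_zero, one_mul]
  -- split the exponential: e^{-r²/4τ} = e^{-r²/8τ} e^{-r²/8τ}
  have hsplit : Real.exp (-‖x‖ ^ 2 / (4 * τ)) =
      Real.exp (-‖x‖ ^ 2 / (8 * τ)) * Real.exp (-‖x‖ ^ 2 / (4 * (2 * τ))) := by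
    rw [← Real.exp_add]
    congr 1
    field_simp
    ring
  rw [hK1, hK2, hnorm, hsplit]
  have hpos1 : 0 ≤ (2 : ℝ) ^ ((d : ℝ) / 2) * (4 * Real.pi * (2 * τ)) ^ (-(d : ℝ) / 2) := by positivity
  have hpos2 : 0 ≤ Real.exp (-‖x‖ ^ 2 / (4 * (2 * τ))) := (Real.exp_pos _).le
  calc (2 * τ)⁻¹ * ((2 : ℝ) ^ ((d : ℝ) / 2) * (4 * Real.pi * (2 * τ)) ^ (-(d : ℝ) / 2) *
        (Real.exp (-‖x‖ ^ 2 / (8 * τ)) * Real.exp (-‖x‖ ^ 2 / (4 * (2 * τ))))) * ‖x‖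
      = (2 * τ)⁻¹ * (‖x‖ * Real.exp (-‖x‖ ^ 2 / (8 * τ))) *
          ((2 : ℝ) ^ ((d : ℝ) / 2) * ((4 * Real.pi * (2 * τ)) ^ (-(d : ℝ) / 2) *
            Real.exp (-‖x‖ ^ 2 / (4 * (2 * τ))))) := by ring
    _ ≤ (2 * τ)⁻¹ * (2 * Real.sqrt τ) *
          ((2 : ℝ) ^ ((d : ℝ) / 2) * ((4 * Real.pi * (2 * τ)) ^ (-(d : ℝ) / 2) *
            Real.exp (-‖x‖ ^ 2 / (4 * (2 * τ))))) := by gcongr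
    _ = (2 : ℝ) ^ ((d : ℝ) / 2) * (Real.sqrt τ)⁻¹ *
          ((4 * Real.pi * (2 * τ)) ^ (-(d : ℝ) / 2) * Real.exp (-‖x‖ ^ 2 / (4 * (2 * τ)))) := by
        have hst : Real.sqrt τ ≠ 0 := (Real.sqrt_pos.mpr hτ).ne'
        have hsq : Real.sqrt τ * Real.sqrt τ = τ := Real.mul_self_sqrt hτ.le
        field_simp
        nlinarith [hsq]

/-- **Semigroup property of the caloric extension of a tempered function**:
`e^{(s+τ)Δ}u (y) = ∫ K_τ(y - w) e^{sΔ}u (w) dw` for `s, τ > 0`. [folklore] -/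
theorem heatExtension_add_eq_integral {u : E → ℝ} {K : ℕ}
    (hfw : Integrable fun w => ((1 + ‖w‖) ^ K)⁻¹ * u w) {s τ : ℝ} (hs : 0 < s) (hτ : 0 < τ) (y : E) :
    heatExtension u (s + τ) y = ∫ w, heatKernel τ (y - w) * heatExtension u s w := by
  have hu : AEStronglyMeasurable u volume := aestronglyMeasurable_of_growth hfw
  -- the integrand on `E × E`, ordered `(z, w)`
  set F : E → E → ℝ := fun z w => heatKernel τ (y - w) * (heatKernel s (w - z) * u z) with hF
  have hFint : Integrable (Function.uncurry F) (volume.prod volume) := by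
    have hmeas : AEStronglyMeasurable (Function.uncurry F) (volume.prod volume) := by
      have hcτ : Continuous (heatKernel (E := E) τ) := Literature.Analysis.UnboundedOperators.continuous_heatKernel τ
      have hcs : Continuous (heatKernel (E := E) s) := Literature.Analysis.UnboundedOperators.continuous_heatKernel s
      have h1 : Continuous fun p : E × E => heatKernel τ (y - p.2) * heatKernel s (p.2 - p.1) := by
        fun_prop
      have h2 : AEStronglyMeasurable (fun p : E × E => u p.1) (volume.prod volume) := hu.comp_fst
      refine (h1.aestronglyMeasurable.mul h2).congr (Eventually.of_forall fun p => ?_)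
      show heatKernel τ (y - p.2) * heatKernel s (p.2 - p.1) * u p.1 = F p.1 p.2
      simp only [hF]
      ring
    rw [integrable_prod_iff hmeas]
    constructor
    · refine Eventually.of_forall fun z => ?_
      show Integrable (fun w => heatKernel τ (y - w) * (heatKernel s (w - z) * u z))
      have h1 : Integrable fun w : E => heatKernel τ (y - w) :=
        (Literature.Analysis.UnboundedOperators.integrable_heatKernel_holds hτ).comp_sub_left y
      have h2 : Integrable fun w : E => (heatKernel s (w - z) * u z) * heatKernel τ (y - w) := by
        refine h1.bdd_mul (c := (4 * Real.pi * s) ^ (-(Module.finrank ℝ E : ℝ) / 2) * |u z|)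
          (((Literature.Analysis.UnboundedOperators.continuous_heatKernel s).comp (continuous_id.sub continuous_const)).mul
            continuous_const).aestronglyMeasurable (Eventually.of_forall fun w => ?_)
        rw [norm_mul, Real.norm_eq_abs, Real.norm_eq_abs,
          abs_of_pos (show 0 < heatKernel s (w - z) from Literature.Analysis.UnboundedOperators.heatKernel_pos hs _)]
        exact mul_le_mul_of_nonneg_right (Literature.Analysis.UnboundedOperators.heatKernel_le hs _) (abs_nonneg _)
      exact h2.congr (Eventually.of_forall fun w => mul_comm _ _)
    · have hnorm : ∀ z, ∫ w, ‖F z w‖ = heatKernel (s + τ) (y - z) * |u z| := by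
        intro z
        have h1 : (fun w => ‖F z w‖) = fun w => heatKernel τ (y - w) * heatKernel s (w - z) * |u z| := by
          funext w
          simp only [hF, norm_mul, Real.norm_eq_abs]
          rw [abs_of_pos (show 0 < heatKernel τ (y - w) from Literature.Analysis.UnboundedOperators.heatKernel_pos hτ _),
            abs_of_pos (show 0 < heatKernel s (w - z) from Literature.Analysis.UnboundedOperators.heatKernel_pos hs _)]
          ring
        rw [h1, integral_mul_const, integral_heatKernel_mul_heatKernel hs hτ]
      have hint : Integrable fun z => heatKernel (s + τ) (y - z) * |u z| := by
        have := integrable_mul_heatKernel_of_growth (integrable_growth_abs hfw) (add_pos hs hτ) y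
        exact this.congr (Eventually.of_forall fun z => mul_comm _ _)
      refine hint.congr (Eventually.of_forall fun z => ?_)
      exact (hnorm z).symm
  -- compute both iterated integrals
  have hswap := integral_integral_swap hFint
  -- `∫ z, ∫ w, F z w = ∫ w, ∫ z, F z w`
  have lhs : ∫ z, ∫ w, F z w = heatExtension u (s + τ) y := by
    show ∫ z, ∫ w, heatKernel τ (y - w) * (heatKernel s (w - z) * u z) = ∫ z, heatKernel (s + τ) (y - z) * u z
    refine integral_congr_ae (Eventually.of_forall fun z => ?_)
    show ∫ w, heatKernel τ (y - w) * (heatKernel s (w - z) * u z) = heatKernel (s + τ) (y - z) * u z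
    have h1 : (fun w => heatKernel τ (y - w) * (heatKernel s (w - z) * u z)) =
        fun w => heatKernel τ (y - w) * heatKernel s (w - z) * u z := by
      funext w; ring
    rw [h1, integral_mul_const, integral_heatKernel_mul_heatKernel hs hτ]
  have rhs : ∫ w, ∫ z, F z w = ∫ w, heatKernel τ (y - w) * heatExtension u s w := by
    refine integral_congr_ae (Eventually.of_forall fun w => ?_)
    show ∫ z, heatKernel τ (y - w) * (heatKernel s (w - z) * u z) = _
    rw [integral_const_mul]
    rfl
  rw [← lhs, hswap, rhs]

/-- **Semigroup property for the gradient of the caloric extension of a tempered function**: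
`∇e^{(s+τ)Δ}u (y) = ∫ e^{sΔ}u (w) ∇K_τ(y - w) dw` for `s, τ > 0`. [folklore] -/
theorem heatExtensionGrad_add_eq_integral {u : E → ℝ} {K : ℕ}
    (hfw : Integrable fun w => ((1 + ‖w‖) ^ K)⁻¹ * u w) {s τ : ℝ} (hs : 0 < s) (hτ : 0 < τ) (y : E) :
    heatExtensionGrad u (s + τ) y = ∫ w, heatExtension u s w • heatKernelGrad τ (y - w) := by
  have hu : AEStronglyMeasurable u volume := aestronglyMeasurable_of_growth hfw
  set A : ℝ := (2 : ℝ) ^ ((Module.finrank ℝ E : ℝ) / 2) * (Real.sqrt τ)⁻¹ with hA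
  set F : E → E → E := fun z w => (heatKernel s (w - z) * u z) • heatKernelGrad τ (y - w) with hF
  have hFint : Integrable (Function.uncurry F) (volume.prod volume) := by
    have hmeas : AEStronglyMeasurable (Function.uncurry F) (volume.prod volume) := by
      have hcs : Continuous (heatKernel (E := E) s) := Literature.Analysis.UnboundedOperators.continuous_heatKernel s
      have hcg : Continuous (heatKernelGrad (E := E) τ) := continuous_heatKernelGrad τ
      have h1 : Continuous fun p : E × E => heatKernel s (p.2 - p.1) := by fun_prop
      have h3 : Continuous fun p : E × E => heatKernelGrad τ (y - p.2) := by fun_prop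
      have h2 : AEStronglyMeasurable (fun p : E × E => u p.1) (volume.prod volume) := hu.comp_fst
      exact (h1.aestronglyMeasurable.mul h2).smul h3.aestronglyMeasurable
    rw [integrable_prod_iff hmeas]
    constructor
    · refine Eventually.of_forall fun z => ?_
      show Integrable (fun w => (heatKernel s (w - z) * u z) • heatKernelGrad τ (y - w))
      have h1 : Integrable fun w : E => heatKernel s (w - z) * u z :=
        ((Literature.Analysis.UnboundedOperators.integrable_heatKernel_holds hs).comp_sub_right z).mul_const _
      have hcont : Continuous fun w : E => heatKernelGrad τ (y - w) :=
        (continuous_heatKernelGrad τ).comp (continuous_const.sub continuous_id)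
      have h2 : MemLp (fun w : E => heatKernelGrad τ (y - w)) ∞ volume :=
        memLp_top_of_bound hcont.aestronglyMeasurable _
          (Eventually.of_forall fun w => norm_heatKernelGrad_le_const hτ (y - w))
      exact h1.smul_of_top_left h2
    · have hbound : ∀ z, ∫ w, ‖F z w‖ ≤ A * (heatKernel (s + 2 * τ) (y - z) * |u z|) := by
        intro z
        have h1 : ∀ w, ‖F z w‖ ≤ A * (heatKernel (2 * τ) (y - w) * heatKernel s (w - z) * |u z|) := by
          intro w
          simp only [hF, norm_smul, norm_mul, Real.norm_eq_abs]
          rw [abs_of_pos (show 0 < heatKernel s (w - z) from Literature.Analysis.UnboundedOperators.heatKernel_pos hs _)]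
          have := norm_heatKernelGrad_le_mul_heatKernel_two_mul hτ (y - w)
          have hK : 0 ≤ heatKernel s (w - z) := (Literature.Analysis.UnboundedOperators.heatKernel_pos hs _).le
          calc heatKernel s (w - z) * |u z| * ‖heatKernelGrad τ (y - w)‖
              ≤ heatKernel s (w - z) * |u z| * (A * heatKernel (2 * τ) (y - w)) := by gcongr
            _ = A * (heatKernel (2 * τ) (y - w) * heatKernel s (w - z) * |u z|) := by ring
        have hint : Integrable fun w => A * (heatKernel (2 * τ) (y - w) * heatKernel s (w - z) * |u z|) := by
          have h2 : Integrable fun w : E => heatKernel (2 * τ) (y - w) :=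
            (Literature.Analysis.UnboundedOperators.integrable_heatKernel_holds (by positivity)).comp_sub_left y
          have h3 : Integrable fun w : E => (heatKernel s (w - z) * |u z|) * heatKernel (2 * τ) (y - w) := by
            refine h2.bdd_mul (c := (4 * Real.pi * s) ^ (-(Module.finrank ℝ E : ℝ) / 2) * |u z|)
              (((Literature.Analysis.UnboundedOperators.continuous_heatKernel s).comp (continuous_id.sub continuous_const)).mul
                continuous_const).aestronglyMeasurable (Eventually.of_forall fun w => ?_)
            rw [norm_mul, Real.norm_eq_abs, Real.norm_eq_abs, abs_abs,
              abs_of_pos (show 0 < heatKernel s (w - z) from Literature.Analysis.UnboundedOperators.heatKernel_pos hs _)]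
            exact mul_le_mul_of_nonneg_right (Literature.Analysis.UnboundedOperators.heatKernel_le hs _) (abs_nonneg _)
          refine (h3.const_mul A).congr (Eventually.of_forall fun w => ?_)
          simp only
          ring
        calc ∫ w, ‖F z w‖ ≤ ∫ w, A * (heatKernel (2 * τ) (y - w) * heatKernel s (w - z) * |u z|) :=
              integral_mono_of_nonneg (Eventually.of_forall fun w => norm_nonneg _) hint
                (Eventually.of_forall h1)
          _ = A * ((∫ w, heatKernel (2 * τ) (y - w) * heatKernel s (w - z)) * |u z|) := by
              rw [integral_const_mul, ← integral_mul_const]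
          _ = A * (heatKernel (s + 2 * τ) (y - z) * |u z|) := by
              rw [integral_heatKernel_mul_heatKernel hs (by positivity)]
      have hint : Integrable fun z => A * (heatKernel (s + 2 * τ) (y - z) * |u z|) := by
        have := integrable_mul_heatKernel_of_growth (integrable_growth_abs hfw)
          (show 0 < s + 2 * τ by positivity) y
        exact (this.congr (Eventually.of_forall fun z => mul_comm _ _)).const_mul A
      refine hint.mono' hmeas.norm.integral_prod_right' ?_
      exact Eventually.of_forall fun z => (by
        rw [Real.norm_of_nonneg (integral_nonneg fun w => norm_nonneg _)]
        exact hbound z)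
  have hswap := integral_integral_swap hFint
  have lhs : ∫ z, ∫ w, F z w = heatExtensionGrad u (s + τ) y := by
    show ∫ z, ∫ w, (heatKernel s (w - z) * u z) • heatKernelGrad τ (y - w) =
      ∫ z, u z • heatKernelGrad (s + τ) (y - z)
    refine integral_congr_ae (Eventually.of_forall fun z => ?_)
    show ∫ w, (heatKernel s (w - z) * u z) • heatKernelGrad τ (y - w) = u z • heatKernelGrad (s + τ) (y - z)
    have h1 : (fun w => (heatKernel s (w - z) * u z) • heatKernelGrad τ (y - w)) =
        fun w => u z • (heatKernel s (w - z) • heatKernelGrad τ (y - w)) := by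
      funext w
      rw [mul_comm, mul_smul]
    rw [h1, integral_smul, integral_heatKernel_smul_heatKernelGrad hs hτ]
  have rhs : ∫ w, ∫ z, F z w = ∫ w, heatExtension u s w • heatKernelGrad τ (y - w) := by
    refine integral_congr_ae (Eventually.of_forall fun w => ?_)
    show ∫ z, (heatKernel s (w - z) * u z) • heatKernelGrad τ (y - w) = _
    rw [integral_smul_const]
    rfl
  rw [← lhs, hswap, rhs]

end Tempered

/-! ## Koch–Tataru's pointwise bound (22): `|e^{tΔ}u|² ≤ C γ / t` -/

section Pointwise

variable {E : Type*} [NormedAddCommGroup E] [InnerProductSpace ℝ E] [FiniteDimensional ℝ E]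
  [MeasurableSpace E] [BorelSpace E]

/-- One Carleson box is bounded by Koch–Tataru's Carleson quantity (definition of the supremum):
`∫₀^{R²}∫_{B(x,R)} |e^{tΔ}u|² ≤ γ R^d`. [folklore] -/
theorem lintegral_box_le_eCarlesonNorm (u : E → ℝ) (x : E) {R : ℝ} (hR : 0 < R) :
    ∫⁻ t in Set.Ioo 0 (R ^ 2), ∫⁻ y in ball x R, ‖heatExtension u t y‖ₑ ^ 2 ≤
      eCarlesonNorm u * ENNReal.ofReal (R ^ Module.finrank ℝ E) := by
  have h : (ENNReal.ofReal (R ^ Module.finrank ℝ E))⁻¹ *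
      ∫⁻ t in Set.Ioo 0 (R ^ 2), ∫⁻ y in ball x R, ‖heatExtension u t y‖ₑ ^ 2 ≤ eCarlesonNorm u :=
    le_iSup_of_le x (le_iSup₂_of_le R hR le_rfl)
  have hRd : ENNReal.ofReal (R ^ Module.finrank ℝ E) ≠ 0 := by
    rw [ne_eq, ENNReal.ofReal_eq_zero, not_le]; positivity
  calc ∫⁻ t in Set.Ioo 0 (R ^ 2), ∫⁻ y in ball x R, ‖heatExtension u t y‖ₑ ^ 2
      = ENNReal.ofReal (R ^ Module.finrank ℝ E) * ((ENNReal.ofReal (R ^ Module.finrank ℝ E))⁻¹ *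
          ∫⁻ t in Set.Ioo 0 (R ^ 2), ∫⁻ y in ball x R, ‖heatExtension u t y‖ₑ ^ 2) := by
        rw [← mul_assoc, ENNReal.mul_inv_cancel hRd ENNReal.ofReal_ne_top, one_mul]
    _ ≤ ENNReal.ofReal (R ^ Module.finrank ℝ E) * eCarlesonNorm u := by gcongr
    _ = _ := mul_comm _ _

/-- Product-set form of `lintegral_box_le_eCarlesonNorm`, for any time interval inside
`(0, R²)`. [folklore] -/
theorem lintegral_prod_ball_le_eCarlesonNorm (u : E → ℝ) (x : E) {R : ℝ} (hR : 0 < R)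
    {s : Set ℝ} (hs : s ⊆ Set.Ioo 0 (R ^ 2)) :
    ∫⁻ p in s ×ˢ ball x R, ‖heatExtension u p.1 p.2‖ₑ ^ 2 ≤
      eCarlesonNorm u * ENNReal.ofReal (R ^ Module.finrank ℝ E) := by
  refine (lintegral_mono_set (Set.prod_mono hs subset_rfl)).trans ?_
  refine (setLIntegral_prod_le _ _ _).trans ?_
  exact lintegral_box_le_eCarlesonNorm u x hR

omit [FiniteDimensional ℝ E] [MeasurableSpace E] [BorelSpace E] in
/-- `t^{d/2} = (√t)^d`. [folklore] -/
theorem rpow_finrank_div_two_eq_sqrt_pow {t : ℝ} (ht : 0 ≤ t) :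
    t ^ ((Module.finrank ℝ E : ℝ) / 2) = Real.sqrt t ^ Module.finrank ℝ E := by
  rw [Real.sqrt_eq_rpow, ← Real.rpow_natCast, ← Real.rpow_mul ht]
  congr 1
  ring

omit [FiniteDimensional ℝ E] [MeasurableSpace E] [BorelSpace E] in
/-- The kernels `K_{t-σ}`, `σ ∈ (t/4, t/2)`, are dominated by one Gaussian at scale `t`:
`K_{t-σ}(x) ≤ ((2π)^{d/2} (√t)^d)⁻¹ e^{-‖x‖²/(3t)}`. [folklore] -/
theorem heatKernel_sub_time_le {t σ : ℝ} (ht : 0 < t) (hσ : σ ∈ Set.Ioo (t / 4) (t / 2)) (x : E) :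
    heatKernel (t - σ) x ≤
      ((2 * Real.pi) ^ ((Module.finrank ℝ E : ℝ) / 2) * Real.sqrt t ^ Module.finrank ℝ E)⁻¹ *
        Real.exp (-‖x‖ ^ 2 / (3 * t)) := by
  set d : ℕ := Module.finrank ℝ E with hd
  have h1 : t / 2 ≤ t - σ := by linarith [hσ.2]
  have h2 : t - σ ≤ 3 * t / 4 := by linarith [hσ.1]
  have hts : 0 < t - σ := by linarith
  have hK : heatKernel (t - σ) x =
      (4 * Real.pi * (t - σ)) ^ (-(d : ℝ) / 2) * Real.exp (-‖x‖ ^ 2 / (4 * (t - σ))) := rfl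
  rw [hK]
  have hA : (4 * Real.pi * (t - σ)) ^ (-(d : ℝ) / 2) ≤
      ((2 * Real.pi) ^ ((d : ℝ) / 2) * Real.sqrt t ^ d)⁻¹ := by
    have e1 : ((2 * Real.pi) ^ ((d : ℝ) / 2) * Real.sqrt t ^ d) = (2 * Real.pi * t) ^ ((d : ℝ) / 2) := by
      rw [← rpow_finrank_div_two_eq_sqrt_pow (E := E) ht.le, ← hd,
        ← Real.mul_rpow (by positivity) ht.le]
    rw [e1, ← Real.rpow_neg (by positivity), show -(d : ℝ) / 2 = -((d : ℝ) / 2) by ring]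
    refine Real.rpow_le_rpow_of_nonpos (by positivity) (by nlinarith [Real.pi_pos]) ?_
    exact neg_nonpos.mpr (by positivity)
  have hB : Real.exp (-‖x‖ ^ 2 / (4 * (t - σ))) ≤ Real.exp (-‖x‖ ^ 2 / (3 * t)) := by
    rw [Real.exp_le_exp, neg_div, neg_div, neg_le_neg_iff]
    exact div_le_div_of_nonneg_left (by positivity) (by positivity) (by linarith)
  exact mul_le_mul hA hB (Real.exp_pos _).le (by positivity)

/-- The Gaussian integral at scale `t`: `∫ e^{-‖x‖²/(3t)} dx = (3π)^{d/2} (√t)^d`. [folklore] -/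
theorem integral_exp_neg_norm_sq_div_three_mul {t : ℝ} (ht : 0 < t) :
    ∫ x : E, Real.exp (-‖x‖ ^ 2 / (3 * t)) =
      (3 * Real.pi) ^ ((Module.finrank ℝ E : ℝ) / 2) * Real.sqrt t ^ Module.finrank ℝ E := by
  have hb : 0 < 1 / (3 * t) := by positivity
  have h := GaussianFourier.integral_rexp_neg_mul_sq_norm (V := E) hb
  have e1 : (fun x : E => Real.exp (-‖x‖ ^ 2 / (3 * t))) = fun x : E => Real.exp (-(1 / (3 * t)) * ‖x‖ ^ 2) := by
    funext x; congr 1; ring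
  rw [e1, h, ← rpow_finrank_div_two_eq_sqrt_pow (E := E) ht.le, ← Real.mul_rpow (by positivity) ht.le]
  congr 1
  field_simp

/-- The elementary shell weight bound: `e^{-4^j/3} 2^{(j+1)d} ≤ ((d+1)! 3^{d+1} 2^d) 2^{-j}`. [folklore] -/
theorem exp_neg_four_pow_mul_le (d j : ℕ) :
    Real.exp (-((4 : ℝ) ^ j / 3)) * 2 ^ ((j + 1) * d) ≤
      ((d + 1).factorial * 3 ^ (d + 1) * 2 ^ d) * (1 / 2 : ℝ) ^ j := by
  have h := pow_mul_exp_neg_le (show (0 : ℝ) < 1 / 3 by norm_num) (d + 1)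
    (show (0 : ℝ) ≤ 4 ^ j by positivity)
  have e1 : Real.exp (-(1 / 3 * (4 : ℝ) ^ j)) = Real.exp (-((4 : ℝ) ^ j / 3)) := by
    congr 1; ring
  have e2 : ((d + 1).factorial : ℝ) / (1 / 3) ^ (d + 1) = (d + 1).factorial * 3 ^ (d + 1) := by
    rw [one_div, inv_pow, div_inv_eq_mul]
  rw [e1, e2] at h
  -- `2^{(j+1)d} ≤ 2^d (1/2)^j (4^j)^{d+1}`
  have hpow : (2 : ℝ) ^ ((j + 1) * d) ≤ 2 ^ d * (1 / 2 : ℝ) ^ j * ((4 : ℝ) ^ j) ^ (d + 1) := by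
    have e3 : ((4 : ℝ) ^ j) ^ (d + 1) = 2 ^ j * 2 ^ (j * (2 * d + 1)) := by
      rw [show (4 : ℝ) = 2 ^ 2 by norm_num, ← pow_mul, ← pow_mul, ← pow_add]
      congr 1
      ring
    have e4 : (2 : ℝ) ^ d * (1 / 2 : ℝ) ^ j * ((4 : ℝ) ^ j) ^ (d + 1) = 2 ^ (d + j * (2 * d + 1)) := by
      rw [e3, pow_add 2 d, show (2 : ℝ) ^ d * (1 / 2 : ℝ) ^ j * (2 ^ j * 2 ^ (j * (2 * d + 1))) =
        2 ^ d * (((1 / 2 : ℝ) * 2) ^ j) * 2 ^ (j * (2 * d + 1)) by rw [mul_pow]; ring]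
      norm_num
    rw [e4]
    exact pow_le_pow_right₀ (by norm_num) (by nlinarith)
  have hX : 0 ≤ Real.exp (-((4 : ℝ) ^ j / 3)) := (Real.exp_pos _).le
  calc Real.exp (-((4 : ℝ) ^ j / 3)) * 2 ^ ((j + 1) * d)
      ≤ Real.exp (-((4 : ℝ) ^ j / 3)) * (2 ^ d * (1 / 2 : ℝ) ^ j * ((4 : ℝ) ^ j) ^ (d + 1)) :=
        mul_le_mul_of_nonneg_left hpow hX
    _ = 2 ^ d * (1 / 2 : ℝ) ^ j * (((4 : ℝ) ^ j) ^ (d + 1) * Real.exp (-((4 : ℝ) ^ j / 3))) := by ring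
    _ ≤ 2 ^ d * (1 / 2 : ℝ) ^ j * ((d + 1).factorial * 3 ^ (d + 1)) := by gcongr
    _ = ((d + 1).factorial * 3 ^ (d + 1) * 2 ^ d) * (1 / 2 : ℝ) ^ j := by ring

/-- Tonelli on a time slab: `∫⁻_{s × E} F = ∫⁻_{t ∈ s} ∫⁻_E F(t, ·)`. [folklore] -/
theorem setLIntegral_prod_univ_eq {F : ℝ × E → ℝ≥0∞} (hF : Measurable F) (s : Set ℝ) :
    ∫⁻ p in s ×ˢ (Set.univ : Set E), F p = ∫⁻ t in s, ∫⁻ y, F (t, y) := by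
  rw [show (volume : Measure (ℝ × E)).restrict (s ×ˢ Set.univ) = (volume.restrict s).prod volume by
    rw [Measure.restrict_prod_eq_prod_univ, ← Measure.volume_eq_prod]]
  exact lintegral_prod _ hF.aemeasurable

omit [InnerProductSpace ℝ E] [FiniteDimensional ℝ E] [MeasurableSpace E] [BorelSpace E] in
/-- A time slab is covered by the tent over `B(y, r)` and the slabs over the dyadic shells. [folklore] -/
theorem prod_univ_subset_union_iUnion_shell [NormedSpace ℝ E] (s : Set ℝ) (y : E) {r : ℝ} (hr : 0 < r) :
    s ×ˢ (Set.univ : Set E) ⊆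
      s ×ˢ ball y r ∪ ⋃ j : ℕ, s ×ˢ (ball y (2 ^ (j + 1) * r) \ ball y (2 ^ j * r)) := by
  intro p hp
  by_cases h : p.2 ∈ ball y r
  · exact Or.inl ⟨hp.1, h⟩
  · have := compl_ball_subset_iUnion_shell y hr h
    obtain ⟨j, hj⟩ := Set.mem_iUnion.mp this
    exact Or.inr (Set.mem_iUnion.mpr ⟨j, hp.1, hj⟩)

/-- **Koch–Tataru's pointwise bound (22)** (Koch–Tataru 2001, (22), for the caloric extension
itself: the sub-mean-value property of caloric functions combined with the Carleson condition):
there is `C = C(E)` such that for every tempered `u` with finite Carleson quantity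
`γ = sup_{x,R} R^{-d}∫₀^{R²}∫_{B(x,R)} |e^{sΔ}u|²` and every `t > 0`, `y`,
`|e^{tΔ}u (y)|² ≤ C γ / t`. Proof: `e^{tΔ}u = e^{(t-σ)Δ}e^{σΔ}u` for `σ ∈ (t/4, t/2)`, the kernels
`K_{t-σ}` are dominated by one Gaussian at scale `t`, Cauchy–Schwarz in `(σ, w)`, and the dyadic
shells `B(y, 2^{j+1}√t) ∖ B(y, 2^j√t)` each carry Carleson mass `γ (2^{j+1}√t)^d` against the
Gaussian factor `e^{-4^j/3}`. [cite: KochTataruAdvMath2001, (22)] -/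
theorem exists_sq_heatExtension_le :
    ∃ C : ℝ, 0 ≤ C ∧ ∀ {u : E → ℝ} {K : ℕ},
      (Integrable fun w => ((1 + ‖w‖) ^ K)⁻¹ * u w) → eCarlesonNorm u < ∞ →
      ∀ {t : ℝ}, 0 < t → ∀ y : E,
        heatExtension u t y ^ 2 ≤ C * (eCarlesonNorm u).toReal / t := by
  set d : ℕ := Module.finrank ℝ E with hd
  set cA : ℝ := (3 * Real.pi) ^ ((d : ℝ) / 2) / (2 * Real.pi) ^ ((d : ℝ) / 2) with hcA
  set Ce : ℝ := (d + 1).factorial * 3 ^ (d + 1) * 2 ^ d with hCe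
  set cB : ℝ := (1 + 2 * Ce) / (2 * Real.pi) ^ ((d : ℝ) / 2) with hcB
  refine ⟨4 * cA * cB, by positivity, ?_⟩
  intro u K hfw hγ t ht y
  set γ := eCarlesonNorm u with hγdef
  set γr : ℝ := γ.toReal with hγr
  have hγr0 : 0 ≤ γr := ENNReal.toReal_nonneg
  have hγe : γ = ENNReal.ofReal γr := (ENNReal.ofReal_toReal hγ.ne).symm
  set r : ℝ := Real.sqrt t with hr
  have hr0 : 0 < r := Real.sqrt_pos.mpr ht
  have hr2 : r ^ 2 = t := Real.sq_sqrt ht.le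
  set P : ℝ := (2 * Real.pi) ^ ((d : ℝ) / 2) * r ^ d with hP
  have hP0 : 0 < P := by positivity
  set S : Set ℝ := Set.Ioo (t / 4) (t / 2) with hS
  have hu : AEStronglyMeasurable u volume := aestronglyMeasurable_of_growth hfw
  set w8 : ℝ × E → ℝ := fun p => Real.exp (-‖y - p.2‖ ^ 2 / (3 * t)) with hw8
  set Uₑ : ℝ × E → ℝ≥0∞ := fun p => ‖heatExtension u p.1 p.2‖ₑ with hU
  have hw8c : Continuous w8 := by rw [hw8]; fun_prop
  have hw8m : Measurable w8 := hw8c.measurable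
  have hw80 : ∀ p, 0 ≤ w8 p := fun p => (Real.exp_pos _).le
  have hw81 : ∀ p, w8 p ≤ 1 := fun p => by
    rw [hw8]
    simp only
    rw [Real.exp_le_one_iff, neg_div]
    exact neg_nonpos.mpr (by positivity)
  have hUm : Measurable Uₑ := (measurable_heatExtension hu).enorm
  -- Step 1-2: average the semigroup representation over `σ ∈ S`
  have hstep : ENNReal.ofReal (t / 4) * ‖heatExtension u t y‖ₑ ≤
      ENNReal.ofReal P⁻¹ * ∫⁻ p in S ×ˢ (Set.univ : Set E), ENNReal.ofReal (w8 p) * Uₑ p := by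
    have hσ : ∀ σ ∈ S, ‖heatExtension u t y‖ₑ ≤
        ENNReal.ofReal P⁻¹ * ∫⁻ w, ENNReal.ofReal (w8 (σ, w)) * Uₑ (σ, w) := by
      intro σ hσ
      have hσ0 : 0 < σ := by linarith [hσ.1]
      have hτ0 : 0 < t - σ := by linarith [hσ.2]
      have hrep := heatExtension_add_eq_integral hfw hσ0 hτ0 y
      rw [show σ + (t - σ) = t by ring] at hrep
      calc ‖heatExtension u t y‖ₑ
          = ‖∫ w, heatKernel (t - σ) (y - w) * heatExtension u σ w‖ₑ := by rw [hrep]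
        _ ≤ ∫⁻ w, ‖heatKernel (t - σ) (y - w) * heatExtension u σ w‖ₑ :=
            enorm_integral_le_lintegral_enorm _
        _ ≤ ∫⁻ w, ENNReal.ofReal P⁻¹ * (ENNReal.ofReal (w8 (σ, w)) * Uₑ (σ, w)) := by
            refine lintegral_mono fun w => ?_
            rw [enorm_mul, Real.enorm_of_nonneg
              (show (0 : ℝ) ≤ heatKernel (t - σ) (y - w) from (Literature.Analysis.UnboundedOperators.heatKernel_pos hτ0 _).le),
              ← mul_assoc, ← ENNReal.ofReal_mul (by positivity)]
            gcongr
            exact heatKernel_sub_time_le ht hσ (y - w)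
        _ = _ := by
            rw [lintegral_const_mul]
            exact ((Measurable.ennreal_ofReal (hw8m.comp measurable_prodMk_left)).mul
              (hUm.comp measurable_prodMk_left))
    have h1 : ENNReal.ofReal (t / 4) * ‖heatExtension u t y‖ₑ = ∫⁻ σ in S, ‖heatExtension u t y‖ₑ := by
      rw [setLIntegral_const, hS, Real.volume_Ioo, show t / 2 - t / 4 = t / 4 by ring, mul_comm]
    rw [h1]
    calc ∫⁻ σ in S, ‖heatExtension u t y‖ₑ
        ≤ ∫⁻ σ in S, ENNReal.ofReal P⁻¹ * ∫⁻ w, ENNReal.ofReal (w8 (σ, w)) * Uₑ (σ, w) :=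
          setLIntegral_mono' measurableSet_Ioo fun σ hσ' => hσ σ hσ'
      _ = ENNReal.ofReal P⁻¹ * ∫⁻ σ in S, ∫⁻ w, ENNReal.ofReal (w8 (σ, w)) * Uₑ (σ, w) := by
          rw [lintegral_const_mul]
          exact ((Measurable.ennreal_ofReal hw8m).mul hUm).lintegral_prod_right'
      _ = _ := by
          rw [setLIntegral_prod_univ_eq (F := fun p => ENNReal.ofReal (w8 p) * Uₑ p)
            ((Measurable.ennreal_ofReal hw8m).mul hUm)]
  -- Step 3: Cauchy–Schwarz in `(σ, w)`
  have h2 : ∀ x : ℝ≥0∞, x ^ (2 : ℝ) = x ^ 2 := fun x => by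
    rw [show (2 : ℝ) = ((2 : ℕ) : ℝ) by norm_num, ENNReal.rpow_natCast]
  have hCS : ∫⁻ p in S ×ˢ (Set.univ : Set E), ENNReal.ofReal (w8 p) * Uₑ p ≤
      (∫⁻ p in S ×ˢ (Set.univ : Set E), ENNReal.ofReal (w8 p)) ^ (1 / 2 : ℝ) *
        (∫⁻ p in S ×ˢ (Set.univ : Set E), ENNReal.ofReal (w8 p) * Uₑ p ^ 2) ^ (1 / 2 : ℝ) := by
    set f : ℝ × E → ℝ≥0∞ := fun p => ENNReal.ofReal (Real.sqrt (w8 p)) with hf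
    set g : ℝ × E → ℝ≥0∞ := fun p => ENNReal.ofReal (Real.sqrt (w8 p)) * Uₑ p with hg
    have hfm : Measurable f := Measurable.ennreal_ofReal (hw8m.sqrt)
    have hgm : Measurable g := hfm.mul hUm
    have hH := ENNReal.lintegral_mul_le_Lp_mul_Lq (volume.restrict (S ×ˢ (Set.univ : Set E)))
      Real.HolderConjugate.two_two hfm.aemeasurable hgm.aemeasurable
    have hsq : ∀ p, ENNReal.ofReal (Real.sqrt (w8 p)) * ENNReal.ofReal (Real.sqrt (w8 p)) =
        ENNReal.ofReal (w8 p) := fun p => by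
      rw [← ENNReal.ofReal_mul (Real.sqrt_nonneg _), Real.mul_self_sqrt (hw80 p)]
    have efg : (fun p => (f * g) p) = fun p => ENNReal.ofReal (w8 p) * Uₑ p := by
      funext p
      simp only [hf, hg, Pi.mul_apply]
      rw [← mul_assoc, hsq]
    have ef : (fun p => f p ^ (2 : ℝ)) = fun p => ENNReal.ofReal (w8 p) := by
      funext p
      rw [h2, hf, sq, hsq]
    have eg : (fun p => g p ^ (2 : ℝ)) = fun p => ENNReal.ofReal (w8 p) * Uₑ p ^ 2 := by
      funext p
      rw [h2, hg]
      simp only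
      rw [mul_pow, sq (ENNReal.ofReal _), hsq]
    rw [efg, ef, eg] at hH
    exact hH
  -- Step 4: the Gaussian mass of the slab
  have hA : ∫⁻ p in S ×ˢ (Set.univ : Set E), ENNReal.ofReal (w8 p) =
      ENNReal.ofReal (t / 4 * ((3 * Real.pi) ^ ((d : ℝ) / 2) * r ^ d)) := by
    rw [setLIntegral_prod_univ_eq (F := fun p => ENNReal.ofReal (w8 p)) (Measurable.ennreal_ofReal hw8m)]
    have hinner : ∀ σ : ℝ, ∫⁻ w, ENNReal.ofReal (w8 (σ, w)) =
        ENNReal.ofReal ((3 * Real.pi) ^ ((d : ℝ) / 2) * r ^ d) := by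
      intro σ
      have hb : 0 < 1 / (3 * t) := by positivity
      have hint : Integrable fun w : E => Real.exp (-‖y - w‖ ^ 2 / (3 * t)) := by
        have := (Literature.Analysis.UnboundedOperators.integrable_gaussian_of_pos (E := E) hb).comp_sub_left y
        refine this.congr (Eventually.of_forall fun w => ?_)
        simp only
        congr 1
        ring
      show ∫⁻ w, ENNReal.ofReal (Real.exp (-‖y - w‖ ^ 2 / (3 * t))) = _
      rw [← ofReal_integral_eq_lintegral_ofReal hint (Eventually.of_forall fun w => (Real.exp_pos _).le)]
      congr 1
      rw [integral_sub_left_eq_self (fun x : E => Real.exp (-‖x‖ ^ 2 / (3 * t))) volume y]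
      exact integral_exp_neg_norm_sq_div_three_mul ht
    simp_rw [hinner]
    rw [setLIntegral_const, hS, Real.volume_Ioo, ← ENNReal.ofReal_mul' (by linarith)]
    congr 1
    ring
  -- Step 5: the Gaussian-weighted Carleson sum over the slab
  have hB : ∫⁻ p in S ×ˢ (Set.univ : Set E), ENNReal.ofReal (w8 p) * Uₑ p ^ 2 ≤
      γ * ENNReal.ofReal (r ^ d * (1 + 2 * Ce)) := by
    have hSsub : ∀ j : ℕ, S ⊆ Set.Ioo 0 ((2 ^ j * r) ^ 2) := by
      intro j σ hσ
      refine ⟨by linarith [hσ.1], ?_⟩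
      have h4 : (1 : ℝ) ≤ (2 ^ j) ^ 2 := one_le_pow₀ (one_le_pow₀ (by norm_num))
      calc σ < t / 2 := hσ.2
        _ ≤ t := by linarith
        _ ≤ (2 ^ j) ^ 2 * t := le_mul_of_one_le_left ht.le h4
        _ = (2 ^ j * r) ^ 2 := by rw [mul_pow, hr2]
    -- tent
    have htent : ∫⁻ p in S ×ˢ ball y r, ENNReal.ofReal (w8 p) * Uₑ p ^ 2 ≤ γ * ENNReal.ofReal (r ^ d) := by
      calc ∫⁻ p in S ×ˢ ball y r, ENNReal.ofReal (w8 p) * Uₑ p ^ 2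
          ≤ ∫⁻ p in S ×ˢ ball y r, Uₑ p ^ 2 := by
            refine lintegral_mono fun p => ?_
            calc ENNReal.ofReal (w8 p) * Uₑ p ^ 2 ≤ 1 * Uₑ p ^ 2 := by
                  gcongr
                  exact ENNReal.ofReal_le_one.mpr (hw81 p)
              _ = Uₑ p ^ 2 := one_mul _
        _ ≤ γ * ENNReal.ofReal (r ^ d) := by
            have := lintegral_prod_ball_le_eCarlesonNorm u y hr0 (by simpa using hSsub 0)
            exact this
    -- shells
    have hshell : ∀ j : ℕ,
        ∫⁻ p in S ×ˢ (ball y (2 ^ (j + 1) * r) \ ball y (2 ^ j * r)), ENNReal.ofReal (w8 p) * Uₑ p ^ 2 ≤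
          γ * ENNReal.ofReal (Ce * r ^ d * (1 / 2 : ℝ) ^ j) := by
      intro j
      have hwj : ∀ p ∈ S ×ˢ (ball y (2 ^ (j + 1) * r) \ ball y (2 ^ j * r)),
          ENNReal.ofReal (w8 p) ≤ ENNReal.ofReal (Real.exp (-((4 : ℝ) ^ j / 3))) := by
        intro p hp
        refine ENNReal.ofReal_le_ofReal ?_
        rw [hw8]
        simp only
        rw [Real.exp_le_exp, neg_div, neg_le_neg_iff]
        have hp2 : 2 ^ j * r ≤ ‖y - p.2‖ := by
          have := hp.2.2
          rw [mem_ball_iff_norm, not_lt, norm_sub_rev] at this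
          exact this
        have h3 : (2 ^ j * r) ^ 2 ≤ ‖y - p.2‖ ^ 2 := pow_le_pow_left₀ (by positivity) hp2 2
        rw [le_div_iff₀ (by positivity)]
        calc (4 : ℝ) ^ j / 3 * (3 * t) = (2 ^ j * r) ^ 2 := by
              rw [mul_pow, hr2, ← pow_mul, show (4 : ℝ) = 2 ^ 2 by norm_num, ← pow_mul]
              ring
          _ ≤ ‖y - p.2‖ ^ 2 := h3
      calc ∫⁻ p in S ×ˢ (ball y (2 ^ (j + 1) * r) \ ball y (2 ^ j * r)), ENNReal.ofReal (w8 p) * Uₑ p ^ 2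
          ≤ ∫⁻ p in S ×ˢ (ball y (2 ^ (j + 1) * r) \ ball y (2 ^ j * r)),
              ENNReal.ofReal (Real.exp (-((4 : ℝ) ^ j / 3))) * Uₑ p ^ 2 :=
            setLIntegral_mono' (measurableSet_Ioo.prod (measurableSet_ball.diff measurableSet_ball))
              fun p hp => mul_le_mul_left (hwj p hp) _
        _ = ENNReal.ofReal (Real.exp (-((4 : ℝ) ^ j / 3))) *
              ∫⁻ p in S ×ˢ (ball y (2 ^ (j + 1) * r) \ ball y (2 ^ j * r)), Uₑ p ^ 2 := by
            rw [lintegral_const_mul _ (hUm.pow_const 2)]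
        _ ≤ ENNReal.ofReal (Real.exp (-((4 : ℝ) ^ j / 3))) *
              ∫⁻ p in S ×ˢ ball y (2 ^ (j + 1) * r), Uₑ p ^ 2 := by
            gcongr
            exact sdiff_le
        _ ≤ ENNReal.ofReal (Real.exp (-((4 : ℝ) ^ j / 3))) *
              (γ * ENNReal.ofReal ((2 ^ (j + 1) * r) ^ d)) := by
            gcongr
            exact lintegral_prod_ball_le_eCarlesonNorm u y (by positivity) (hSsub (j + 1))
        _ = γ * ENNReal.ofReal (Real.exp (-((4 : ℝ) ^ j / 3)) * 2 ^ ((j + 1) * d) * r ^ d) := by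
            rw [mul_left_comm, ← ENNReal.ofReal_mul (Real.exp_pos _).le]
            congr 2
            rw [mul_pow, ← pow_mul]
            ring
        _ ≤ γ * ENNReal.ofReal (Ce * r ^ d * (1 / 2 : ℝ) ^ j) := by
            gcongr γ * ENNReal.ofReal ?_
            have := exp_neg_four_pow_mul_le d j
            calc Real.exp (-((4 : ℝ) ^ j / 3)) * 2 ^ ((j + 1) * d) * r ^ d
                ≤ (((d + 1).factorial * 3 ^ (d + 1) * 2 ^ d) * (1 / 2 : ℝ) ^ j) * r ^ d :=
                  mul_le_mul_of_nonneg_right this (by positivity)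
              _ = Ce * r ^ d * (1 / 2 : ℝ) ^ j := by rw [hCe]; ring
    -- sum up
    have hcover := prod_univ_subset_union_iUnion_shell S y hr0
    calc ∫⁻ p in S ×ˢ (Set.univ : Set E), ENNReal.ofReal (w8 p) * Uₑ p ^ 2
        ≤ ∫⁻ p in S ×ˢ ball y r ∪ ⋃ j : ℕ, S ×ˢ (ball y (2 ^ (j + 1) * r) \ ball y (2 ^ j * r)),
            ENNReal.ofReal (w8 p) * Uₑ p ^ 2 := lintegral_mono_set hcover
      _ ≤ (∫⁻ p in S ×ˢ ball y r, ENNReal.ofReal (w8 p) * Uₑ p ^ 2) +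
            ∫⁻ p in ⋃ j : ℕ, S ×ˢ (ball y (2 ^ (j + 1) * r) \ ball y (2 ^ j * r)),
              ENNReal.ofReal (w8 p) * Uₑ p ^ 2 := lintegral_union_le _ _ _
      _ ≤ γ * ENNReal.ofReal (r ^ d) +
            ∑' j : ℕ, ∫⁻ p in S ×ˢ (ball y (2 ^ (j + 1) * r) \ ball y (2 ^ j * r)),
              ENNReal.ofReal (w8 p) * Uₑ p ^ 2 := add_le_add htent (lintegral_iUnion_le _ _)
      _ ≤ γ * ENNReal.ofReal (r ^ d) + ∑' j : ℕ, γ * ENNReal.ofReal (Ce * r ^ d * (1 / 2 : ℝ) ^ j) :=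
          add_le_add le_rfl (ENNReal.tsum_le_tsum hshell)
      _ = γ * ENNReal.ofReal (r ^ d) + γ * ENNReal.ofReal (Ce * r ^ d * 2) := by
          congr 1
          rw [ENNReal.tsum_mul_left]
          congr 1
          rw [← ENNReal.ofReal_tsum_of_nonneg (fun j => by positivity) (summable_geometric_two.mul_left _)]
          congr 1
          rw [tsum_mul_left, tsum_geometric_two]
      _ = γ * ENNReal.ofReal (r ^ d * (1 + 2 * Ce)) := by
          rw [← mul_add, ← ENNReal.ofReal_add (by positivity) (by positivity)]
          congr 2
          ring
  -- Step 6: assemble and return to the reals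
  set Z : ℝ := P⁻¹ * (Real.sqrt (t / 4 * ((3 * Real.pi) ^ ((d : ℝ) / 2) * r ^ d)) *
    Real.sqrt (γr * (r ^ d * (1 + 2 * Ce)))) with hZ
  have hZ0 : 0 ≤ Z := by positivity
  have hfinal : ENNReal.ofReal (t / 4 * |heatExtension u t y|) ≤ ENNReal.ofReal Z := by
    have e1 : ENNReal.ofReal (t / 4 * |heatExtension u t y|) =
        ENNReal.ofReal (t / 4) * ‖heatExtension u t y‖ₑ := by
      rw [ENNReal.ofReal_mul (by positivity), Real.enorm_eq_ofReal_abs]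
    rw [e1]
    refine hstep.trans ?_
    have hmid : ENNReal.ofReal P⁻¹ * ∫⁻ p in S ×ˢ (Set.univ : Set E), ENNReal.ofReal (w8 p) * Uₑ p ≤
        ENNReal.ofReal P⁻¹ * ((ENNReal.ofReal (t / 4 * ((3 * Real.pi) ^ ((d : ℝ) / 2) * r ^ d))) ^ (1 / 2 : ℝ) *
          (γ * ENNReal.ofReal (r ^ d * (1 + 2 * Ce))) ^ (1 / 2 : ℝ)) := by
      rw [← hA]
      gcongr
      exact hCS.trans (by gcongr)
    refine hmid.trans (le_of_eq ?_)
    rw [hγe, ← ENNReal.ofReal_mul hγr0, ENNReal.ofReal_rpow_of_nonneg (by positivity) (by norm_num),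
      ENNReal.ofReal_rpow_of_nonneg (by positivity) (by norm_num), ← Real.sqrt_eq_rpow,
      ← Real.sqrt_eq_rpow, ← ENNReal.ofReal_mul (Real.sqrt_nonneg _),
      ← ENNReal.ofReal_mul (by positivity), hZ]
  have hreal : t / 4 * |heatExtension u t y| ≤ Z := (ENNReal.ofReal_le_ofReal_iff hZ0).mp hfinal
  have habs : |heatExtension u t y| ≤ Z / (t / 4) := by
    rw [le_div_iff₀ (by positivity), mul_comm]; exact hreal
  have hZsq : (Z / (t / 4)) ^ 2 = 4 * cA * cB * γr / t := by
    have hrd : r ^ d ≠ 0 := by positivity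
    have h2π : (2 * Real.pi) ^ ((d : ℝ) / 2) ≠ 0 := by positivity
    rw [div_pow, hZ, mul_pow, mul_pow, Real.sq_sqrt (by positivity), Real.sq_sqrt (by positivity),
      hP, hcA, hcB]
    field_simp
  calc heatExtension u t y ^ 2 = |heatExtension u t y| ^ 2 := (sq_abs _).symm
    _ ≤ (Z / (t / 4)) ^ 2 := pow_le_pow_left₀ (abs_nonneg _) habs 2
    _ = 4 * cA * cB * γr / t := hZsq
    _ = 4 * cA * cB * (eCarlesonNorm u).toReal / t := by rw [hγr]

/-- `|e^{tΔ}u (y)| ≤ C₀^{1/2} γ^{1/2} t^{-1/2}` (square-root form of `exists_sq_heatExtension_le`). [folklore] -/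
theorem exists_abs_heatExtension_le :
    ∃ C : ℝ, 0 ≤ C ∧ ∀ {u : E → ℝ} {K : ℕ},
      (Integrable fun w => ((1 + ‖w‖) ^ K)⁻¹ * u w) → eCarlesonNorm u < ∞ →
      ∀ {t : ℝ}, 0 < t → ∀ y : E,
        |heatExtension u t y| ≤ C * Real.sqrt (eCarlesonNorm u).toReal / Real.sqrt t := by
  obtain ⟨C, hC0, hC⟩ := exists_sq_heatExtension_le (E := E)
  refine ⟨Real.sqrt C, Real.sqrt_nonneg _, @fun u K hfw hγ t ht y => ?_⟩
  have h := hC hfw hγ ht y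
  have h1 : |heatExtension u t y| ≤ Real.sqrt (C * (eCarlesonNorm u).toReal / t) := Real.abs_le_sqrt h
  rwa [Real.sqrt_div (by positivity), Real.sqrt_mul hC0] at h1

/-- The `L¹` norm of the gradient kernel: `∫ ‖∇K_τ‖ ≤ 2^{d/2} τ^{-1/2}`. [folklore] -/
theorem lintegral_enorm_heatKernelGrad_le' {τ : ℝ} (hτ : 0 < τ) :
    ∫⁻ x, ‖heatKernelGrad τ x‖ₑ ∂(volume : Measure E) ≤
      ENNReal.ofReal ((2 : ℝ) ^ ((Module.finrank ℝ E : ℝ) / 2) * (Real.sqrt τ)⁻¹) := by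
  set A : ℝ := (2 : ℝ) ^ ((Module.finrank ℝ E : ℝ) / 2) * (Real.sqrt τ)⁻¹ with hA
  have hA0 : 0 ≤ A := by positivity
  have hint : Integrable (heatKernel (E := E) (2 * τ)) := Literature.Analysis.UnboundedOperators.integrable_heatKernel_holds (by positivity)
  calc ∫⁻ x, ‖heatKernelGrad τ x‖ₑ ∂(volume : Measure E)
      ≤ ∫⁻ x, ENNReal.ofReal (A * heatKernel (2 * τ) x) := by
        refine lintegral_mono fun x => ?_
        rw [← ofReal_norm]
        exact ENNReal.ofReal_le_ofReal (norm_heatKernelGrad_le_mul_heatKernel_two_mul hτ x)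
    _ = ENNReal.ofReal A * ∫⁻ x, ENNReal.ofReal (heatKernel (2 * τ) x) := by
        rw [← lintegral_const_mul' _ _ ENNReal.ofReal_ne_top]
        refine lintegral_congr fun x => ?_
        rw [ENNReal.ofReal_mul hA0]
    _ = ENNReal.ofReal A * ENNReal.ofReal (∫ x, heatKernel (2 * τ) x) := by
        rw [ofReal_integral_eq_lintegral_ofReal hint
          (Eventually.of_forall fun x => (Literature.Analysis.UnboundedOperators.heatKernel_pos (by positivity) x).le)]
    _ = ENNReal.ofReal A := by
        rw [show ∫ x, heatKernel (2 * τ) x = (1 : ℝ) from Literature.Analysis.UnboundedOperators.integral_heatKernel_eq_one_holds (by positivity),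
          ENNReal.ofReal_one, mul_one]

omit [MeasurableSpace E] [BorelSpace E] in
/-- The heat kernel along a segment: `θ ↦ K_τ(v + θ a)` has derivative `⟪∇K_τ(v + θ a), a⟫`. [folklore] -/
theorem hasDerivAt_heatKernel_segment (τ : ℝ) (v a : E) (θ : ℝ) :
    HasDerivAt (fun θ : ℝ => heatKernel τ (v + θ • a)) ⟪heatKernelGrad τ (v + θ • a), a⟫ θ := by
  haveI : CompleteSpace E := FiniteDimensional.complete ℝ E
  have h1 : HasDerivAt (fun θ : ℝ => v + θ • a) a θ := by
    simpa using ((hasDerivAt_id θ).smul_const a).const_add v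
  have h2 := (hasGradientAt_heatKernel τ (v + θ • a)).hasFDerivAt
  have h3 := h2.comp_hasDerivAt θ h1
  simp only [InnerProductSpace.toDual_apply_apply] at h3
  exact h3

/-- **Translation modulus of the heat kernel in `L¹`**: `∫ |K_τ(v + a) - K_τ(v)| dv ≤ ‖a‖ ‖∇K_τ‖₁`. [folklore] -/
theorem lintegral_enorm_heatKernel_add_sub_le {τ : ℝ} (hτ : 0 < τ) (a : E) :
    ∫⁻ v, ‖heatKernel τ (v + a) - heatKernel τ v‖ₑ ∂(volume : Measure E) ≤
      ENNReal.ofReal (‖a‖ * ((2 : ℝ) ^ ((Module.finrank ℝ E : ℝ) / 2) * (Real.sqrt τ)⁻¹)) := by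
  set A : ℝ := (2 : ℝ) ^ ((Module.finrank ℝ E : ℝ) / 2) * (Real.sqrt τ)⁻¹ with hA
  -- pointwise FTC bound
  have hpt : ∀ v : E, ‖heatKernel τ (v + a) - heatKernel τ v‖ₑ ≤
      ∫⁻ θ in Set.Ioc (0 : ℝ) 1, ‖heatKernelGrad τ (v + θ • a)‖ₑ * ‖a‖ₑ := by
    intro v
    have hcont : Continuous fun θ : ℝ => ⟪heatKernelGrad τ (v + θ • a), a⟫ := by
      have := continuous_heatKernelGrad (E := E) τ
      fun_prop
    have hFTC : ∫ θ in (0 : ℝ)..1, ⟪heatKernelGrad τ (v + θ • a), a⟫ =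
        heatKernel τ (v + (1 : ℝ) • a) - heatKernel τ (v + (0 : ℝ) • a) :=
      intervalIntegral.integral_eq_sub_of_hasDerivAt (fun θ _ => hasDerivAt_heatKernel_segment τ v a θ)
        (hcont.intervalIntegrable 0 1)
    simp only [one_smul, zero_smul, add_zero] at hFTC
    rw [← hFTC, intervalIntegral.integral_of_le zero_le_one]
    calc ‖∫ θ in Set.Ioc (0 : ℝ) 1, ⟪heatKernelGrad τ (v + θ • a), a⟫‖ₑ
        ≤ ∫⁻ θ in Set.Ioc (0 : ℝ) 1, ‖⟪heatKernelGrad τ (v + θ • a), a⟫‖ₑ :=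
          enorm_integral_le_lintegral_enorm _
      _ ≤ _ := lintegral_mono fun θ => by
          rw [← ofReal_norm, ← ofReal_norm, ← ofReal_norm,
            ← ENNReal.ofReal_mul (norm_nonneg _)]
          exact ENNReal.ofReal_le_ofReal (norm_inner_le_norm _ _)
  -- integrate and swap
  have hmeas : Measurable fun q : E × ℝ => ‖heatKernelGrad τ (q.1 + q.2 • a)‖ₑ * ‖a‖ₑ := by
    have := continuous_heatKernelGrad (E := E) τ
    have h1 : Continuous fun q : E × ℝ => heatKernelGrad τ (q.1 + q.2 • a) := by fun_prop
    exact h1.measurable.enorm.mul_const _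
  calc ∫⁻ v, ‖heatKernel τ (v + a) - heatKernel τ v‖ₑ
      ≤ ∫⁻ v, ∫⁻ θ in Set.Ioc (0 : ℝ) 1, ‖heatKernelGrad τ (v + θ • a)‖ₑ * ‖a‖ₑ := lintegral_mono hpt
    _ = ∫⁻ θ in Set.Ioc (0 : ℝ) 1, ∫⁻ v, ‖heatKernelGrad τ (v + θ • a)‖ₑ * ‖a‖ₑ :=
        lintegral_lintegral_swap (hmeas.aemeasurable)
    _ = ∫⁻ θ in Set.Ioc (0 : ℝ) 1, (∫⁻ v, ‖heatKernelGrad τ v‖ₑ ∂(volume : Measure E)) * ‖a‖ₑ := by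
        refine lintegral_congr fun θ => ?_
        have hmv : Measurable fun v : E => ‖heatKernelGrad τ (v + θ • a)‖ₑ :=
          ((continuous_heatKernelGrad τ).comp (continuous_id.add continuous_const)).measurable.enorm
        rw [lintegral_mul_const _ hmv, lintegral_add_right_eq_self (fun v => ‖heatKernelGrad τ v‖ₑ) (θ • a)]
    _ ≤ ∫⁻ θ in Set.Ioc (0 : ℝ) 1, ENNReal.ofReal A * ‖a‖ₑ := by
        refine lintegral_mono fun θ => ?_
        gcongr
        exact lintegral_enorm_heatKernelGrad_le' hτ
    _ = ENNReal.ofReal (‖a‖ * A) := by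
        rw [setLIntegral_const, Real.volume_Ioc, sub_zero, ENNReal.ofReal_one, mul_one,
          ← ofReal_norm, ← ENNReal.ofReal_mul (by positivity), mul_comm]

/-- The gradient kernel as a convolution of the kernel with the gradient kernel at half times,
in the form `∇K_τ(x) = ∫ K_{τ/2}(x - y) ∇K_{τ/2}(y) dy`. [folklore] -/
theorem heatKernelGrad_eq_integral_half {τ : ℝ} (hτ : 0 < τ) (x : E) :
    heatKernelGrad τ x = ∫ y, heatKernel (τ / 2) (x - y) • heatKernelGrad (τ / 2) y := by
  have h := heatKernelGrad_add_eq_integral (E := E) (half_pos hτ) (half_pos hτ) x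
  rw [add_halves] at h
  rw [h, ← integral_sub_left_eq_self (fun y => heatKernel (τ / 2) (x - y) • heatKernelGrad (τ / 2) y) volume x]
  refine integral_congr_ae (Eventually.of_forall fun y => ?_)
  simp only [sub_sub_cancel]

/-- **Translation modulus of the gradient kernel in `L¹`**:
`∫ ‖∇K_τ(v + a) - ∇K_τ(v)‖ dv ≤ ‖a‖ ‖∇K_{τ/2}‖₁² ≤ ‖a‖ (2^{d/2} (τ/2)^{-1/2})²`. [folklore] -/
theorem lintegral_enorm_heatKernelGrad_add_sub_le {τ : ℝ} (hτ : 0 < τ) (a : E) :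
    ∫⁻ v, ‖heatKernelGrad τ (v + a) - heatKernelGrad τ v‖ₑ ∂(volume : Measure E) ≤
      ENNReal.ofReal (‖a‖ * ((2 : ℝ) ^ ((Module.finrank ℝ E : ℝ) / 2) * (Real.sqrt (τ / 2))⁻¹) ^ 2) := by
  set A : ℝ := (2 : ℝ) ^ ((Module.finrank ℝ E : ℝ) / 2) * (Real.sqrt (τ / 2))⁻¹ with hA
  have hA0 : 0 ≤ A := by positivity
  have hτ2 : 0 < τ / 2 := half_pos hτ
  -- integrability of `y ↦ K(x - y) ∇K(y)`
  have hint : ∀ x : E, Integrable fun y => heatKernel (τ / 2) (x - y) • heatKernelGrad (τ / 2) y := by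
    intro x
    have h1 : Integrable (heatKernelGrad (E := E) (τ / 2)) := integrable_heatKernelGrad hτ2
    have hK : Continuous fun y : E => heatKernel (τ / 2) (x - y) := continuous_heatKernel_sub _ x
    refine h1.smul_of_top_right ?_
    exact memLp_top_of_bound hK.aestronglyMeasurable _
      (Eventually.of_forall fun y => by
        rw [Real.norm_of_nonneg (show (0 : ℝ) ≤ heatKernel (τ / 2) (x - y) from (Literature.Analysis.UnboundedOperators.heatKernel_pos hτ2 _).le)]
        exact Literature.Analysis.UnboundedOperators.heatKernel_le hτ2 _)
  have hdiff : ∀ v : E, heatKernelGrad τ (v + a) - heatKernelGrad τ v =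
      ∫ y, (heatKernel (τ / 2) (v + a - y) - heatKernel (τ / 2) (v - y)) • heatKernelGrad (τ / 2) y := by
    intro v
    rw [heatKernelGrad_eq_integral_half hτ (v + a), heatKernelGrad_eq_integral_half hτ v,
      ← integral_sub (hint (v + a)) (hint v)]
    refine integral_congr_ae (Eventually.of_forall fun y => ?_)
    simp only [sub_smul]
  have hpt : ∀ v : E, ‖heatKernelGrad τ (v + a) - heatKernelGrad τ v‖ₑ ≤
      ∫⁻ y, ‖heatKernel (τ / 2) (v + a - y) - heatKernel (τ / 2) (v - y)‖ₑ * ‖heatKernelGrad (τ / 2) y‖ₑ := by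
    intro v
    rw [hdiff v]
    refine (enorm_integral_le_lintegral_enorm _).trans (lintegral_mono fun y => ?_)
    rw [enorm_smul]
  have hKc : Continuous (heatKernel (E := E) (τ / 2)) := Literature.Analysis.UnboundedOperators.continuous_heatKernel _
  have hGc := continuous_heatKernelGrad (E := E) (τ / 2)
  have hmeas : Measurable fun q : E × E =>
      ‖heatKernel (τ / 2) (q.1 + a - q.2) - heatKernel (τ / 2) (q.1 - q.2)‖ₑ * ‖heatKernelGrad (τ / 2) q.2‖ₑ := by
    have h1 : Continuous fun q : E × E =>
        heatKernel (τ / 2) (q.1 + a - q.2) - heatKernel (τ / 2) (q.1 - q.2) := by fun_prop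
    have h2 : Continuous fun q : E × E => heatKernelGrad (τ / 2) q.2 := by fun_prop
    exact h1.measurable.enorm.mul h2.measurable.enorm
  calc ∫⁻ v, ‖heatKernelGrad τ (v + a) - heatKernelGrad τ v‖ₑ
      ≤ ∫⁻ v, ∫⁻ y, ‖heatKernel (τ / 2) (v + a - y) - heatKernel (τ / 2) (v - y)‖ₑ *
          ‖heatKernelGrad (τ / 2) y‖ₑ := lintegral_mono hpt
    _ = ∫⁻ y, ∫⁻ v, ‖heatKernel (τ / 2) (v + a - y) - heatKernel (τ / 2) (v - y)‖ₑ *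
          ‖heatKernelGrad (τ / 2) y‖ₑ := lintegral_lintegral_swap hmeas.aemeasurable
    _ = ∫⁻ y, (∫⁻ v, ‖heatKernel (τ / 2) (v + a) - heatKernel (τ / 2) v‖ₑ ∂(volume : Measure E)) *
          ‖heatKernelGrad (τ / 2) y‖ₑ := by
        refine lintegral_congr fun y => ?_
        have hmv : Measurable fun v : E =>
            ‖heatKernel (τ / 2) (v + a - y) - heatKernel (τ / 2) (v - y)‖ₑ := by
          have : Continuous fun v : E => heatKernel (τ / 2) (v + a - y) - heatKernel (τ / 2) (v - y) := by
            fun_prop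
          exact this.measurable.enorm
        rw [lintegral_mul_const _ hmv]
        congr 1
        rw [← lintegral_sub_right_eq_self
          (fun v : E => ‖heatKernel (τ / 2) (v + a) - heatKernel (τ / 2) v‖ₑ) y]
        refine lintegral_congr fun v => ?_
        simp only [show v + a - y = v - y + a by abel]
    _ ≤ ∫⁻ y, ENNReal.ofReal (‖a‖ * A) * ‖heatKernelGrad (τ / 2) y‖ₑ := by
        refine lintegral_mono fun y => ?_
        gcongr
        exact lintegral_enorm_heatKernel_add_sub_le hτ2 a
    _ = ENNReal.ofReal (‖a‖ * A) * ∫⁻ y, ‖heatKernelGrad (τ / 2) y‖ₑ :=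
        lintegral_const_mul _ hGc.measurable.enorm
    _ ≤ ENNReal.ofReal (‖a‖ * A) * ENNReal.ofReal A := by
        gcongr
        exact lintegral_enorm_heatKernelGrad_le' hτ2
    _ = ENNReal.ofReal (‖a‖ * A ^ 2) := by
        rw [← ENNReal.ofReal_mul (by positivity)]
        congr 1
        ring

/-- A time section of the caloric extension is measurable. [folklore] -/
theorem measurable_heatExtension_section {u : E → ℝ} (hu : AEStronglyMeasurable u volume) (t : ℝ) :
    Measurable fun w : E => heatExtension u t w :=
  (measurable_heatExtension hu).comp (measurable_const.prodMk measurable_id)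

/-- For `F` bounded and measurable, `w ↦ F(w) ∇K_τ(x - w)` is integrable. [folklore] -/
theorem integrable_smul_heatKernelGrad_of_bound {F : E → ℝ} (hF : Measurable F) {M : ℝ}
    (hM : ∀ w, |F w| ≤ M) {τ : ℝ} (hτ : 0 < τ) (x : E) :
    Integrable fun w => F w • heatKernelGrad τ (x - w) := by
  have h1 : Integrable fun w : E => heatKernelGrad τ (x - w) := (integrable_heatKernelGrad hτ).comp_sub_left x
  refine h1.smul_of_top_right ?_
  exact memLp_top_of_bound hF.aestronglyMeasurable M
    (Eventually.of_forall fun w => by rw [Real.norm_eq_abs]; exact hM w)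

/-- **Decay of the gradient of the caloric extension** (from Koch–Tataru's (22)):
`‖∇e^{tΔ}u (y)‖ ≤ C γ^{1/2} / t`, `C = C(E)`. [folklore] -/
theorem exists_norm_heatExtensionGrad_le :
    ∃ C : ℝ, 0 ≤ C ∧ ∀ {u : E → ℝ} {K : ℕ},
      (Integrable fun w => ((1 + ‖w‖) ^ K)⁻¹ * u w) → eCarlesonNorm u < ∞ →
      ∀ {t : ℝ}, 0 < t → ∀ y : E,
        ‖heatExtensionGrad u t y‖ ≤ C * Real.sqrt (eCarlesonNorm u).toReal / t := by
  obtain ⟨C₀, hC₀, hC⟩ := exists_abs_heatExtension_le (E := E)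
  set A1 : ℝ := (2 : ℝ) ^ ((Module.finrank ℝ E : ℝ) / 2) with hA1
  refine ⟨2 * C₀ * A1, by positivity, @fun u K hfw hγ t ht y => ?_⟩
  have ht2 : 0 < t / 2 := half_pos ht
  set γr : ℝ := (eCarlesonNorm u).toReal with hγr
  set M : ℝ := C₀ * Real.sqrt γr / Real.sqrt (t / 2) with hM
  have hM0 : 0 ≤ M := by positivity
  have hMb : ∀ w, |heatExtension u (t / 2) w| ≤ M := fun w => hC hfw hγ ht2 w
  have hu : AEStronglyMeasurable u volume := aestronglyMeasurable_of_growth hfw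
  have hrep : heatExtensionGrad u t y = ∫ w, heatExtension u (t / 2) w • heatKernelGrad (t / 2) (y - w) := by
    have := heatExtensionGrad_add_eq_integral hfw ht2 ht2 y
    rwa [add_halves] at this
  have h1 : ‖heatExtensionGrad u t y‖ₑ ≤ ENNReal.ofReal (M * (A1 * (Real.sqrt (t / 2))⁻¹)) := by
    rw [hrep]
    calc ‖∫ w, heatExtension u (t / 2) w • heatKernelGrad (t / 2) (y - w)‖ₑ
        ≤ ∫⁻ w, ‖heatExtension u (t / 2) w • heatKernelGrad (t / 2) (y - w)‖ₑ :=
          enorm_integral_le_lintegral_enorm _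
      _ ≤ ∫⁻ w, ENNReal.ofReal M * ‖heatKernelGrad (t / 2) (y - w)‖ₑ := by
          refine lintegral_mono fun w => ?_
          rw [enorm_smul]
          gcongr
          rw [Real.enorm_eq_ofReal_abs]
          exact ENNReal.ofReal_le_ofReal (hMb w)
      _ = ENNReal.ofReal M * ∫⁻ w, ‖heatKernelGrad (t / 2) w‖ₑ ∂(volume : Measure E) := by
          have hmv : Measurable fun w : E => ‖heatKernelGrad (t / 2) (y - w)‖ₑ := by
            have := continuous_heatKernelGrad (E := E) (t / 2)
            have : Continuous fun w : E => heatKernelGrad (t / 2) (y - w) := by fun_prop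
            exact this.measurable.enorm
          rw [lintegral_const_mul _ hmv, lintegral_sub_left_eq_self (fun w => ‖heatKernelGrad (t / 2) w‖ₑ) y]
      _ ≤ ENNReal.ofReal M * ENNReal.ofReal (A1 * (Real.sqrt (t / 2))⁻¹) := by
          gcongr
          exact lintegral_enorm_heatKernelGrad_le' ht2
      _ = _ := by rw [← ENNReal.ofReal_mul hM0]
  rw [← ofReal_norm, ENNReal.ofReal_le_ofReal_iff (by positivity)] at h1
  refine h1.trans (le_of_eq ?_)
  have hs : Real.sqrt (t / 2) ≠ 0 := (Real.sqrt_pos.mpr ht2).ne'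
  rw [hM]
  field_simp
  rw [Real.sq_sqrt ht2.le]
  ring

/-- **Lipschitz bound for the gradient of the caloric extension** (from Koch–Tataru's (22)):
`‖∇e^{sΔ}u (x) - ∇e^{sΔ}u (x')‖ ≤ C γ^{1/2} ‖x - x'‖ / (s √s)`, `C = C(E)`. [folklore] -/
theorem exists_norm_heatExtensionGrad_sub_le :
    ∃ C : ℝ, 0 ≤ C ∧ ∀ {u : E → ℝ} {K : ℕ},
      (Integrable fun w => ((1 + ‖w‖) ^ K)⁻¹ * u w) → eCarlesonNorm u < ∞ →
      ∀ {s : ℝ}, 0 < s → ∀ x x' : E,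
        ‖heatExtensionGrad u s x - heatExtensionGrad u s x'‖ ≤
          C * Real.sqrt (eCarlesonNorm u).toReal * ‖x - x'‖ / (s * Real.sqrt s) := by
  obtain ⟨C₀, hC₀, hC⟩ := exists_abs_heatExtension_le (E := E)
  set A1 : ℝ := (2 : ℝ) ^ ((Module.finrank ℝ E : ℝ) / 2) with hA1
  refine ⟨4 * Real.sqrt 2 * C₀ * A1 ^ 2, by positivity, @fun u K hfw hγ s hs x x' => ?_⟩
  have hs2 : 0 < s / 2 := half_pos hs
  set γr : ℝ := (eCarlesonNorm u).toReal with hγr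
  set M : ℝ := C₀ * Real.sqrt γr / Real.sqrt (s / 2) with hM
  have hM0 : 0 ≤ M := by positivity
  have hMb : ∀ w, |heatExtension u (s / 2) w| ≤ M := fun w => hC hfw hγ hs2 w
  have hu : AEStronglyMeasurable u volume := aestronglyMeasurable_of_growth hfw
  have hrep : ∀ z : E, heatExtensionGrad u s z =
      ∫ w, heatExtension u (s / 2) w • heatKernelGrad (s / 2) (z - w) := by
    intro z
    have := heatExtensionGrad_add_eq_integral hfw hs2 hs2 z
    rwa [add_halves] at this
  have hint : ∀ z : E, Integrable fun w => heatExtension u (s / 2) w • heatKernelGrad (s / 2) (z - w) :=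
    fun z => integrable_smul_heatKernelGrad_of_bound (measurable_heatExtension_section hu _) hMb hs2 z
  set a : E := x - x' with ha
  have hdiff : heatExtensionGrad u s x - heatExtensionGrad u s x' =
      ∫ w, heatExtension u (s / 2) w • (heatKernelGrad (s / 2) (x - w) - heatKernelGrad (s / 2) (x' - w)) := by
    rw [hrep x, hrep x', ← integral_sub (hint x) (hint x')]
    refine integral_congr_ae (Eventually.of_forall fun w => ?_)
    simp only [smul_sub]
  set B : ℝ := ‖a‖ * (A1 * (Real.sqrt (s / 2 / 2))⁻¹) ^ 2 with hB
  have hB0 : 0 ≤ B := by positivity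
  have h1 : ‖heatExtensionGrad u s x - heatExtensionGrad u s x'‖ₑ ≤ ENNReal.ofReal (M * B) := by
    rw [hdiff]
    calc ‖∫ w, heatExtension u (s / 2) w • (heatKernelGrad (s / 2) (x - w) - heatKernelGrad (s / 2) (x' - w))‖ₑ
        ≤ ∫⁻ w, ‖heatExtension u (s / 2) w •
            (heatKernelGrad (s / 2) (x - w) - heatKernelGrad (s / 2) (x' - w))‖ₑ :=
          enorm_integral_le_lintegral_enorm _
      _ ≤ ∫⁻ w, ENNReal.ofReal M * ‖heatKernelGrad (s / 2) (x - w) - heatKernelGrad (s / 2) (x' - w)‖ₑ := by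
          refine lintegral_mono fun w => ?_
          rw [enorm_smul]
          gcongr
          rw [Real.enorm_eq_ofReal_abs]
          exact ENNReal.ofReal_le_ofReal (hMb w)
      _ = ENNReal.ofReal M * ∫⁻ v, ‖heatKernelGrad (s / 2) (v + a) - heatKernelGrad (s / 2) v‖ₑ
            ∂(volume : Measure E) := by
          have hmv : Measurable fun w : E =>
              ‖heatKernelGrad (s / 2) (x - w) - heatKernelGrad (s / 2) (x' - w)‖ₑ := by
            have := continuous_heatKernelGrad (E := E) (s / 2)
            have : Continuous fun w : E => heatKernelGrad (s / 2) (x - w) - heatKernelGrad (s / 2) (x' - w) := by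
              fun_prop
            exact this.measurable.enorm
          rw [lintegral_const_mul _ hmv]
          congr 1
          rw [← lintegral_sub_left_eq_self
            (fun v : E => ‖heatKernelGrad (s / 2) (v + a) - heatKernelGrad (s / 2) v‖ₑ) x']
          refine lintegral_congr fun w => ?_
          simp only [ha, show x' - w + (x - x') = x - w by abel]
      _ ≤ ENNReal.ofReal M * ENNReal.ofReal B := by
          gcongr
          exact lintegral_enorm_heatKernelGrad_add_sub_le hs2 a
      _ = _ := by rw [← ENNReal.ofReal_mul hM0]
  rw [← ofReal_norm, ENNReal.ofReal_le_ofReal_iff (by positivity)] at h1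
  refine h1.trans (le_of_eq ?_)
  have hq0 : 0 < Real.sqrt (s / 2) := Real.sqrt_pos.mpr hs2
  have hq : Real.sqrt (s / 2) * Real.sqrt (s / 2) = s / 2 := Real.mul_self_sqrt hs2.le
  have hq4 : Real.sqrt (s / 2 / 2) ^ 2 = s / 2 / 2 := Real.sq_sqrt (by positivity)
  have hq40 : 0 < Real.sqrt (s / 2 / 2) := Real.sqrt_pos.mpr (by positivity)
  have hss : Real.sqrt s * Real.sqrt s = s := Real.mul_self_sqrt hs.le
  have hs0 : 0 < Real.sqrt s := Real.sqrt_pos.mpr hs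
  -- `√(s/2) = √s / √2`
  have hsq2 : Real.sqrt (s / 2) = Real.sqrt s / Real.sqrt 2 := Real.sqrt_div hs.le 2
  have h22 : Real.sqrt 2 * Real.sqrt 2 = 2 := Real.mul_self_sqrt (by norm_num)
  rw [hM, hB, mul_pow, inv_pow, hq4, hsq2]
  field_simp
  ring

end Pointwise

/-! ## The duality pairing `∫ g ⟪∫_ε^T ∇e^{sΔ}u ds, v⟫ = -2 ∫∫ e^{tΔ}u ⟪∇e^{tΔ}g, v⟫` -/

section Pairing

variable {E : Type*} [NormedAddCommGroup E] [InnerProductSpace ℝ E] [FiniteDimensional ℝ E]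
  [MeasurableSpace E] [BorelSpace E]

omit [InnerProductSpace ℝ E] [FiniteDimensional ℝ E] [MeasurableSpace E] [BorelSpace E] in
/-- Peetre, inverted: `((1 + ‖x - z‖)^K)⁻¹ ≤ (1 + ‖x‖)^K ((1 + ‖z‖)^K)⁻¹`. [folklore] -/
theorem inv_one_add_norm_sub_pow_le' [NormedSpace ℝ E] (x z : E) (K : ℕ) :
    ((1 + ‖x - z‖) ^ K)⁻¹ ≤ (1 + ‖x‖) ^ K * ((1 + ‖z‖) ^ K)⁻¹ := by
  have h := one_add_norm_pow_le_mul_pow x z K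
  rw [← div_eq_mul_inv, le_div_iff₀ (by positivity)]
  calc ((1 + ‖x - z‖) ^ K)⁻¹ * (1 + ‖z‖) ^ K
      ≤ ((1 + ‖x - z‖) ^ K)⁻¹ * ((1 + ‖x‖) ^ K * (1 + ‖x - z‖) ^ K) := by gcongr
    _ = (1 + ‖x‖) ^ K := by
        rw [mul_comm ((1 + ‖x‖) ^ K), ← mul_assoc, inv_mul_cancel₀ (by positivity), one_mul]

omit [InnerProductSpace ℝ E] [FiniteDimensional ℝ E] [MeasurableSpace E] [BorelSpace E] in
/-- A bounded function vanishing off `B(x₀, ρ)` against a polynomial weight: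
`|g(x)| (1 + ‖x‖)^K ≤ (1 + ‖x₀‖ + ρ)^K |g(x)|`. [folklore] -/
theorem abs_mul_one_add_norm_pow_le_of_support [NormedSpace ℝ E] {g : E → ℝ} {x₀ : E} {ρ : ℝ}
    (hgs : ∀ z, z ∉ ball x₀ ρ → g z = 0) (K : ℕ) (x : E) :
    |g x| * (1 + ‖x‖) ^ K ≤ (1 + ‖x₀‖ + ρ) ^ K * |g x| := by
  by_cases hx : x ∈ ball x₀ ρ
  · have h1 : ‖x‖ ≤ ‖x₀‖ + ρ := by
      have := norm_le_norm_add_norm_sub' x x₀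
      have h2 : ‖x - x₀‖ < ρ := mem_ball_iff_norm.mp hx
      linarith
    rw [mul_comm]
    exact mul_le_mul_of_nonneg_right (pow_le_pow_left₀ (by positivity) (by linarith) K) (abs_nonneg _)
  · rw [hgs x hx, abs_zero, zero_mul, mul_zero]

omit [MeasurableSpace E] [BorelSpace E] in
/-- `∫ ⟪f, v⟫ = ⟪∫ f, v⟫` (real inner product, constant on the right). [folklore] -/
theorem integral_real_inner_const {α : Type*} [MeasurableSpace α] {μ : Measure α} {f : α → E}
    (hf : Integrable f μ) (v : E) : ∫ x, ⟪f x, v⟫ ∂μ = ⟪∫ x, f x ∂μ, v⟫ := by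
  simp_rw [real_inner_comm v]
  exact integral_inner hf v

/-- **Moving the gradient kernel across**: for tempered `u`, bounded compactly supported `g`
and `s > 0`, `∫ g ⟪∇e^{sΔ}u, v⟫ = -∫ u ⟪∇e^{sΔ}g, v⟫` (Fubini and oddness of `∇K_s`). [folklore] -/
theorem integral_mul_inner_heatExtensionGrad_eq_neg {u g : E → ℝ} {K : ℕ}
    (hfw : Integrable fun w => ((1 + ‖w‖) ^ K)⁻¹ * u w) (hgi : Integrable g) {x₀ : E} {ρ : ℝ}
    (hgs : ∀ z, z ∉ ball x₀ ρ → g z = 0) {s : ℝ} (hs : 0 < s) (v : E) :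
    ∫ x, g x * ⟪heatExtensionGrad u s x, v⟫ = -∫ z, u z * ⟪heatExtensionGrad g s z, v⟫ := by
  have hu : AEStronglyMeasurable u volume := aestronglyMeasurable_of_growth hfw
  obtain ⟨C₁, hC₁0, hC₁⟩ := exists_unif_bound_heatKernelGrad (E := E) K hs le_rfl
  set Bρ : ℝ := (1 + ‖x₀‖ + ρ) ^ K with hBρ
  set F : E → E → ℝ := fun x z => g x * (u z * ⟪heatKernelGrad s (x - z), v⟫) with hF
  have hFint : Integrable (Function.uncurry F) (volume.prod volume) := by
    have hmeas : AEStronglyMeasurable (Function.uncurry F) (volume.prod volume) := by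
      have h1 : AEStronglyMeasurable (fun p : E × E => g p.1) (volume.prod volume) := hgi.1.comp_fst
      have h2 : AEStronglyMeasurable (fun p : E × E => u p.2) (volume.prod volume) := hu.comp_snd
      have hcg := continuous_heatKernelGrad (E := E) s
      have h3 : Continuous fun p : E × E => ⟪heatKernelGrad s (p.1 - p.2), v⟫ := by fun_prop
      exact h1.mul (h2.mul h3.aestronglyMeasurable)
    refine Integrable.mono' ((hgi.norm.const_mul Bρ).mul_prod
      ((integrable_growth_abs hfw).const_mul (C₁ * ‖v‖))) hmeas (Eventually.of_forall fun p => ?_)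
    rcases p with ⟨x, z⟩
    show ‖g x * (u z * ⟪heatKernelGrad s (x - z), v⟫)‖ ≤
      Bρ * ‖g x‖ * (C₁ * ‖v‖ * (((1 + ‖z‖) ^ K)⁻¹ * |u z|))
    rw [norm_mul, norm_mul, Real.norm_eq_abs, Real.norm_eq_abs]
    have hk : ‖heatKernelGrad s (x - z)‖ ≤ C₁ * ((1 + ‖x‖) ^ K * ((1 + ‖z‖) ^ K)⁻¹) := by
      have h1 := hC₁ s ⟨le_rfl, le_rfl⟩ (x - z)
      have h2 : ‖heatKernelGrad s (x - z)‖ ≤ C₁ * ((1 + ‖x - z‖) ^ K)⁻¹ := by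
        rw [← div_eq_mul_inv, le_div_iff₀ (by positivity), mul_comm]; exact h1
      exact h2.trans (mul_le_mul_of_nonneg_left (inv_one_add_norm_sub_pow_le' x z K) hC₁0)
    have hin : ‖⟪heatKernelGrad s (x - z), v⟫‖ ≤ C₁ * ((1 + ‖x‖) ^ K * ((1 + ‖z‖) ^ K)⁻¹) * ‖v‖ :=
      (norm_inner_le_norm _ _).trans (mul_le_mul_of_nonneg_right hk (norm_nonneg _))
    have hgx := abs_mul_one_add_norm_pow_le_of_support hgs K x
    calc |g x| * (|u z| * ‖⟪heatKernelGrad s (x - z), v⟫‖)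
        ≤ |g x| * (|u z| * (C₁ * ((1 + ‖x‖) ^ K * ((1 + ‖z‖) ^ K)⁻¹) * ‖v‖)) := by gcongr
      _ = (|g x| * (1 + ‖x‖) ^ K) * (C₁ * ‖v‖ * (((1 + ‖z‖) ^ K)⁻¹ * |u z|)) := by ring
      _ ≤ (Bρ * |g x|) * (C₁ * ‖v‖ * (((1 + ‖z‖) ^ K)⁻¹ * |u z|)) := by gcongr
      _ = _ := by ring
  have hswap := integral_integral_swap hFint
  -- `∫ x, ∫ z, F x z = ∫ z, ∫ x, F x z`
  have lhs : ∫ x, ∫ z, F x z = ∫ x, g x * ⟪heatExtensionGrad u s x, v⟫ := by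
    refine integral_congr_ae (Eventually.of_forall fun x => ?_)
    show ∫ z, g x * (u z * ⟪heatKernelGrad s (x - z), v⟫) = g x * ⟪heatExtensionGrad u s x, v⟫
    rw [integral_const_mul]
    congr 1
    rw [heatExtensionGrad, ← integral_real_inner_const (integrable_smul_heatKernelGrad_of_growth hfw hs x) v]
    refine integral_congr_ae (Eventually.of_forall fun z => ?_)
    show u z * ⟪heatKernelGrad s (x - z), v⟫ = ⟪u z • heatKernelGrad s (x - z), v⟫
    rw [real_inner_smul_left]
  have rhs : ∫ z, ∫ x, F x z = -∫ z, u z * ⟪heatExtensionGrad g s z, v⟫ := by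
    rw [← integral_neg]
    refine integral_congr_ae (Eventually.of_forall fun z => ?_)
    show ∫ x, g x * (u z * ⟪heatKernelGrad s (x - z), v⟫) = -(u z * ⟪heatExtensionGrad g s z, v⟫)
    have h1 : (fun x => g x * (u z * ⟪heatKernelGrad s (x - z), v⟫)) =
        fun x => -(u z * ⟪g x • heatKernelGrad s (z - x), v⟫) := by
      funext x
      rw [real_inner_smul_left, ← neg_sub z x, heatKernelGrad_neg, inner_neg_left]
      ring
    rw [h1, integral_neg, integral_const_mul,
      integral_real_inner_const (integrable_smul_heatKernelGrad_sub hgi hs z) v]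
    rfl
  rw [← lhs, hswap, rhs]

/-- **`e^{bΔ}` commutes with `∇e^{aΔ}` on `L¹`**: `∇e^{(a+b)Δ}g (z) = ∫ K_b(z - w) ∇e^{aΔ}g (w) dw`. [folklore] -/
theorem heatExtensionGrad_add_eq_integral_heatKernel_smul {g : E → ℝ} (hgi : Integrable g) {a b : ℝ}
    (ha : 0 < a) (hb : 0 < b) (z : E) :
    heatExtensionGrad g (a + b) z = ∫ w, heatKernel b (z - w) • heatExtensionGrad g a w := by
  set F : E → E → E := fun x w => g x • (heatKernel b (z - w) • heatKernelGrad a (w - x)) with hF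
  have hFint : Integrable (Function.uncurry F) (volume.prod volume) := by
    have hmeas : AEStronglyMeasurable (Function.uncurry F) (volume.prod volume) := by
      have h1 : AEStronglyMeasurable (fun p : E × E => g p.1) (volume.prod volume) := hgi.1.comp_fst
      have hcb : Continuous (heatKernel (E := E) b) := Literature.Analysis.UnboundedOperators.continuous_heatKernel b
      have hcg := continuous_heatKernelGrad (E := E) a
      have h3 : Continuous fun p : E × E => heatKernel b (z - p.2) • heatKernelGrad a (p.2 - p.1) := by
        fun_prop
      exact h1.smul h3.aestronglyMeasurable
    set Ma : ℝ := (4 * Real.pi * a) ^ (-(Module.finrank ℝ E : ℝ) / 2) * (Real.sqrt a)⁻¹ with hMa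
    have hKb : Integrable fun w : E => heatKernel b (z - w) := (Literature.Analysis.UnboundedOperators.integrable_heatKernel_holds hb).comp_sub_left z
    refine Integrable.mono' (hgi.norm.mul_prod (hKb.mul_const Ma)) hmeas (Eventually.of_forall fun p => ?_)
    rcases p with ⟨x, w⟩
    show ‖g x • (heatKernel b (z - w) • heatKernelGrad a (w - x))‖ ≤ ‖g x‖ * (heatKernel b (z - w) * Ma)
    rw [norm_smul, norm_smul, Real.norm_of_nonneg (show (0 : ℝ) ≤ heatKernel b (z - w) from
      (Literature.Analysis.UnboundedOperators.heatKernel_pos hb _).le)]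
    exact mul_le_mul_of_nonneg_left (mul_le_mul_of_nonneg_left (norm_heatKernelGrad_le_const ha _)
      (Literature.Analysis.UnboundedOperators.heatKernel_pos hb _).le) (norm_nonneg _)
  have hswap := integral_integral_swap hFint
  have lhs : ∫ x, ∫ w, F x w = heatExtensionGrad g (a + b) z := by
    show ∫ x, ∫ w, g x • (heatKernel b (z - w) • heatKernelGrad a (w - x)) = ∫ x, g x • heatKernelGrad (a + b) (z - x)
    refine integral_congr_ae (Eventually.of_forall fun x => ?_)
    show ∫ w, g x • (heatKernel b (z - w) • heatKernelGrad a (w - x)) = g x • heatKernelGrad (a + b) (z - x)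
    rw [integral_smul]
    congr 1
    have h1 : (fun w => heatKernel b (z - w) • heatKernelGrad a (w - x)) =
        fun w => -(heatKernel b (w - z) • heatKernelGrad a (x - w)) := by
      funext w
      rw [heatKernel_sub_comm b z w, ← smul_neg, ← heatKernelGrad_neg, neg_sub]
    rw [h1, integral_neg, integral_heatKernel_smul_heatKernelGrad hb ha x z, ← heatKernelGrad_neg, neg_sub,
      add_comm]
  have rhs : ∫ w, ∫ x, F x w = ∫ w, heatKernel b (z - w) • heatExtensionGrad g a w := by
    refine integral_congr_ae (Eventually.of_forall fun w => ?_)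
    show ∫ x, g x • (heatKernel b (z - w) • heatKernelGrad a (w - x)) = heatKernel b (z - w) • heatExtensionGrad g a w
    rw [heatExtensionGrad, ← integral_smul]
    refine integral_congr_ae (Eventually.of_forall fun x => ?_)
    show g x • (heatKernel b (z - w) • heatKernelGrad a (w - x)) = heatKernel b (z - w) • (g x • heatKernelGrad a (w - x))
    rw [smul_smul, smul_smul, mul_comm]
  rw [← lhs, hswap, rhs]

/-- `w ↦ K_b(z - w) ∇e^{aΔ}g (w)` is integrable for `g ∈ L¹`. [folklore] -/
theorem integrable_heatKernel_smul_heatExtensionGrad {g : E → ℝ} (hgi : Integrable g) {x₀ : E} {ρ M : ℝ}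
    (hρ : 0 < ρ) (hgM : ∀ z, |g z| ≤ M) (hgs : ∀ z, z ∉ ball x₀ ρ → g z = 0) {a b : ℝ}
    (ha : 0 < a) (hb : 0 < b) (z : E) :
    Integrable fun w => heatKernel b (z - w) • heatExtensionGrad g a w := by
  obtain ⟨C, hC0, hC⟩ := exists_norm_heatExtensionGrad_le_of_support hρ hgM hgs 0 ha le_rfl
  have hKb : Integrable fun w : E => heatKernel b (z - w) := (Literature.Analysis.UnboundedOperators.integrable_heatKernel_holds hb).comp_sub_left z
  refine hKb.smul_of_top_left (memLp_top_of_bound ?_ C (Eventually.of_forall fun w => ?_))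
  · exact ((measurable_heatExtensionGrad hgi.1).comp (measurable_const.prodMk measurable_id)).aestronglyMeasurable
  · simpa using hC a ⟨le_rfl, le_rfl⟩ w

/-- **Splitting the semigroup between `u` and `g`**: for tempered `u`, an atom-like `g` and
`s > 0`, `∫ u ⟪∇e^{sΔ}g, v⟫ = ∫ e^{(s/2)Δ}u ⟪∇e^{(s/2)Δ}g, v⟫`. [folklore] -/
theorem integral_mul_inner_heatExtensionGrad_eq_half {u g : E → ℝ} {K : ℕ}
    (hfw : Integrable fun w => ((1 + ‖w‖) ^ K)⁻¹ * u w) (hgi : Integrable g) {x₀ : E} {ρ M : ℝ}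
    (hρ : 0 < ρ) (hgM : ∀ z, |g z| ≤ M) (hgs : ∀ z, z ∉ ball x₀ ρ → g z = 0) {s : ℝ} (hs : 0 < s)
    (v : E) :
    ∫ z, u z * ⟪heatExtensionGrad g s z, v⟫ =
      ∫ w, heatExtension u (s / 2) w * ⟪heatExtensionGrad g (s / 2) w, v⟫ := by
  have hu : AEStronglyMeasurable u volume := aestronglyMeasurable_of_growth hfw
  have hs2 : 0 < s / 2 := half_pos hs
  set d : ℕ := Module.finrank ℝ E with hd
  obtain ⟨CN, hCN0, hCN⟩ := exists_norm_heatExtensionGrad_le_of_support hρ hgM hgs (K + (d + 1)) hs2 le_rfl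
  obtain ⟨C₂, hC₂0, hC₂⟩ := exists_unif_bound_heatKernel (E := E) K hs2 le_rfl
  set G₀ : E → E := fun w => heatExtensionGrad g (s / 2) w with hG₀
  have hG₀m : AEStronglyMeasurable G₀ volume :=
    ((measurable_heatExtensionGrad hgi.1).comp (measurable_const.prodMk measurable_id)).aestronglyMeasurable
  set F : E → E → ℝ := fun z w => u z * (heatKernel (s / 2) (z - w) * ⟪G₀ w, v⟫) with hF
  -- the integrable majorant in `w`
  have hwt : Integrable fun w : E => ((1 + ‖w - x₀‖) ^ (d + 1))⁻¹ :=
    (integrable_inv_one_add_norm_pow (E := E)).comp_sub_right x₀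
  have hFint : Integrable (Function.uncurry F) (volume.prod volume) := by
    have hmeas : AEStronglyMeasurable (Function.uncurry F) (volume.prod volume) := by
      have h1 : AEStronglyMeasurable (fun p : E × E => u p.1) (volume.prod volume) := hu.comp_fst
      have hcb : Continuous (heatKernel (E := E) (s / 2)) := Literature.Analysis.UnboundedOperators.continuous_heatKernel _
      have h2 : Continuous fun p : E × E => heatKernel (s / 2) (p.1 - p.2) := by fun_prop
      have h3 : AEStronglyMeasurable (fun p : E × E => ⟪G₀ p.2, v⟫) (volume.prod volume) :=
        (hG₀m.inner_const (c := v)).comp_snd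
      exact h1.mul (h2.aestronglyMeasurable.mul h3)
    refine Integrable.mono' ((integrable_growth_abs hfw).mul_prod
      ((hwt.const_mul (C₂ * CN * ‖v‖ * (1 + ‖x₀‖) ^ K)))) hmeas (Eventually.of_forall fun p => ?_)
    rcases p with ⟨z, w⟩
    show ‖u z * (heatKernel (s / 2) (z - w) * ⟪G₀ w, v⟫)‖ ≤
      ((1 + ‖z‖) ^ K)⁻¹ * |u z| * (C₂ * CN * ‖v‖ * (1 + ‖x₀‖) ^ K * ((1 + ‖w - x₀‖) ^ (d + 1))⁻¹)
    rw [norm_mul, norm_mul, Real.norm_eq_abs, Real.norm_of_nonneg (show (0 : ℝ) ≤ heatKernel (s / 2) (z - w)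
      from (Literature.Analysis.UnboundedOperators.heatKernel_pos hs2 _).le)]
    -- kernel: `K(z - w) ≤ C₂ (1 + ‖w‖)^K ((1 + ‖z‖)^K)⁻¹`
    have hk : heatKernel (s / 2) (z - w) ≤ C₂ * ((1 + ‖w‖) ^ K * ((1 + ‖z‖) ^ K)⁻¹) := by
      have h1 := hC₂ (s / 2) ⟨le_rfl, le_rfl⟩ (z - w)
      have h2 : heatKernel (s / 2) (z - w) ≤ C₂ * ((1 + ‖z - w‖) ^ K)⁻¹ := by
        rw [← div_eq_mul_inv, le_div_iff₀ (by positivity), mul_comm]; exact h1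
      refine h2.trans (mul_le_mul_of_nonneg_left ?_ hC₂0)
      have := inv_one_add_norm_sub_pow_le' w z K
      rwa [norm_sub_rev] at this
    -- test side: `‖G₀ w‖ ≤ CN ((1 + ‖w - x₀‖)^{K+d+1})⁻¹`
    have hG : ‖⟪G₀ w, v⟫‖ ≤ CN * ((1 + ‖w - x₀‖) ^ (K + (d + 1)))⁻¹ * ‖v‖ :=
      (norm_inner_le_norm _ _).trans (mul_le_mul_of_nonneg_right (hCN _ ⟨le_rfl, le_rfl⟩ w) (norm_nonneg _))
    -- weights: `(1+‖w‖)^K ((1+‖w-x₀‖)^{K+d+1})⁻¹ ≤ (1+‖x₀‖)^K ((1+‖w-x₀‖)^{d+1})⁻¹`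
    have hwt' : (1 + ‖w‖) ^ K * ((1 + ‖w - x₀‖) ^ (K + (d + 1)))⁻¹ ≤
        (1 + ‖x₀‖) ^ K * ((1 + ‖w - x₀‖) ^ (d + 1))⁻¹ := by
      have hP : (1 + ‖w‖) ^ K ≤ (1 + ‖x₀‖) ^ K * (1 + ‖w - x₀‖) ^ K := by
        have := one_add_norm_pow_le_mul_pow x₀ w K
        rwa [norm_sub_rev] at this
      rw [pow_add, mul_inv]
      calc (1 + ‖w‖) ^ K * (((1 + ‖w - x₀‖) ^ K)⁻¹ * ((1 + ‖w - x₀‖) ^ (d + 1))⁻¹)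
          ≤ ((1 + ‖x₀‖) ^ K * (1 + ‖w - x₀‖) ^ K) *
              (((1 + ‖w - x₀‖) ^ K)⁻¹ * ((1 + ‖w - x₀‖) ^ (d + 1))⁻¹) := by gcongr
        _ = (1 + ‖x₀‖) ^ K * ((1 + ‖w - x₀‖) ^ K * ((1 + ‖w - x₀‖) ^ K)⁻¹) *
              ((1 + ‖w - x₀‖) ^ (d + 1))⁻¹ := by ring
        _ = (1 + ‖x₀‖) ^ K * ((1 + ‖w - x₀‖) ^ (d + 1))⁻¹ := by
            rw [mul_inv_cancel₀ (by positivity), mul_one]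
    calc |u z| * (heatKernel (s / 2) (z - w) * ‖⟪G₀ w, v⟫‖)
        ≤ |u z| * ((C₂ * ((1 + ‖w‖) ^ K * ((1 + ‖z‖) ^ K)⁻¹)) *
            (CN * ((1 + ‖w - x₀‖) ^ (K + (d + 1)))⁻¹ * ‖v‖)) :=
          mul_le_mul_of_nonneg_left (mul_le_mul hk hG (norm_nonneg _) (by positivity)) (abs_nonneg _)
      _ = ((1 + ‖z‖) ^ K)⁻¹ * |u z| * (C₂ * CN * ‖v‖ *
            ((1 + ‖w‖) ^ K * ((1 + ‖w - x₀‖) ^ (K + (d + 1)))⁻¹)) := by ring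
      _ ≤ ((1 + ‖z‖) ^ K)⁻¹ * |u z| * (C₂ * CN * ‖v‖ *
            ((1 + ‖x₀‖) ^ K * ((1 + ‖w - x₀‖) ^ (d + 1))⁻¹)) := by gcongr
      _ = _ := by ring
  have hswap := integral_integral_swap hFint
  have lhs : ∫ z, ∫ w, F z w = ∫ z, u z * ⟪heatExtensionGrad g s z, v⟫ := by
    refine integral_congr_ae (Eventually.of_forall fun z => ?_)
    show ∫ w, u z * (heatKernel (s / 2) (z - w) * ⟪G₀ w, v⟫) = u z * ⟪heatExtensionGrad g s z, v⟫
    rw [integral_const_mul]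
    congr 1
    have h1 := heatExtensionGrad_add_eq_integral_heatKernel_smul hgi hs2 hs2 z
    rw [add_halves] at h1
    rw [h1, ← integral_real_inner_const (integrable_heatKernel_smul_heatExtensionGrad hgi hρ hgM hgs hs2 hs2 z) v]
    refine integral_congr_ae (Eventually.of_forall fun w => ?_)
    show heatKernel (s / 2) (z - w) * ⟪G₀ w, v⟫ = ⟪heatKernel (s / 2) (z - w) • heatExtensionGrad g (s / 2) w, v⟫
    rw [real_inner_smul_left]
  have rhs : ∫ w, ∫ z, F z w = ∫ w, heatExtension u (s / 2) w * ⟪heatExtensionGrad g (s / 2) w, v⟫ := by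
    refine integral_congr_ae (Eventually.of_forall fun w => ?_)
    show ∫ z, u z * (heatKernel (s / 2) (z - w) * ⟪G₀ w, v⟫) = heatExtension u (s / 2) w * ⟪heatExtensionGrad g (s / 2) w, v⟫
    have h1 : (fun z => u z * (heatKernel (s / 2) (z - w) * ⟪G₀ w, v⟫)) =
        fun z => (heatKernel (s / 2) (w - z) * u z) * ⟪G₀ w, v⟫ := by
      funext z
      rw [heatKernel_sub_comm]
      ring
    rw [h1, integral_mul_const]
    rfl
  rw [← lhs, hswap, rhs]

/-- Time sections `s ↦ ∇e^{sΔ}u (x)` are integrable on compact time intervals away from `0`. [folklore] -/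
theorem integrableOn_heatExtensionGrad_time {u : E → ℝ} {K : ℕ}
    (hfw : Integrable fun w => ((1 + ‖w‖) ^ K)⁻¹ * u w) {ε T : ℝ} (hε : 0 < ε) (hεT : ε ≤ T) (x : E) :
    IntegrableOn (fun s => heatExtensionGrad u s x) (Set.Ioo ε T) := by
  have hu : AEStronglyMeasurable u volume := aestronglyMeasurable_of_growth hfw
  obtain ⟨C, hC0, hC⟩ := exists_unif_bound_heatExtensionGrad_of_growth hfw hε hεT
  have hmeas : Measurable fun s : ℝ => heatExtensionGrad u s x :=
    (measurable_heatExtensionGrad hu).comp (measurable_id.prodMk measurable_const)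
  refine Measure.integrableOn_of_bounded (M := C * (1 + ‖x‖) ^ K) measure_Ioo_lt_top.ne
    hmeas.aestronglyMeasurable ?_
  refine (ae_restrict_mem measurableSet_Ioo).mono fun s hs => ?_
  exact hC s ⟨hs.1.le, hs.2.le⟩ x

/-- Restricting `volume` on `ℝ × E` to a time slab gives the product with the restricted time
measure. [folklore] -/
theorem volume_restrict_prod_univ (J : Set ℝ) :
    (volume : Measure (ℝ × E)).restrict (J ×ˢ (Set.univ : Set E)) = (volume.restrict J).prod volume := by
  rw [Measure.restrict_prod_eq_prod_univ, ← Measure.volume_eq_prod]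

omit [InnerProductSpace ℝ E] [FiniteDimensional ℝ E] [MeasurableSpace E] [BorelSpace E] in
/-- The weight bookkeeping `(1+‖w‖)^K ((1+‖w-x₀‖)^{K+n})⁻¹ ≤ (1+‖x₀‖)^K ((1+‖w-x₀‖)^n)⁻¹`. [folklore] -/
theorem one_add_norm_pow_mul_inv_le [NormedSpace ℝ E] (w x₀ : E) (K n : ℕ) :
    (1 + ‖w‖) ^ K * ((1 + ‖w - x₀‖) ^ (K + n))⁻¹ ≤ (1 + ‖x₀‖) ^ K * ((1 + ‖w - x₀‖) ^ n)⁻¹ := by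
  have hP : (1 + ‖w‖) ^ K ≤ (1 + ‖x₀‖) ^ K * (1 + ‖w - x₀‖) ^ K := by
    have := one_add_norm_pow_le_mul_pow x₀ w K
    rwa [norm_sub_rev] at this
  rw [pow_add, mul_inv]
  calc (1 + ‖w‖) ^ K * (((1 + ‖w - x₀‖) ^ K)⁻¹ * ((1 + ‖w - x₀‖) ^ n)⁻¹)
      ≤ ((1 + ‖x₀‖) ^ K * (1 + ‖w - x₀‖) ^ K) *
          (((1 + ‖w - x₀‖) ^ K)⁻¹ * ((1 + ‖w - x₀‖) ^ n)⁻¹) := by gcongr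
    _ = (1 + ‖x₀‖) ^ K * ((1 + ‖w - x₀‖) ^ K * ((1 + ‖w - x₀‖) ^ K)⁻¹) *
          ((1 + ‖w - x₀‖) ^ n)⁻¹ := by ring
    _ = (1 + ‖x₀‖) ^ K * ((1 + ‖w - x₀‖) ^ n)⁻¹ := by
        rw [mul_inv_cancel₀ (by positivity), mul_one]

/-- **Joint integrability of the pairing integrand on a time slab**: for tempered `u`, an
atom-like `g` and `0 < a ≤ b`, `(t, w) ↦ e^{tΔ}u (w) ⟪∇e^{tΔ}g (w), v⟫` is integrable on
`(a, b) × E`. [folklore] -/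
theorem integrable_heatExtension_mul_inner_slab {u g : E → ℝ} {K : ℕ}
    (hfw : Integrable fun w => ((1 + ‖w‖) ^ K)⁻¹ * u w) (hgi : Integrable g) {x₀ : E} {ρ M : ℝ}
    (hρ : 0 < ρ) (hgM : ∀ z, |g z| ≤ M) (hgs : ∀ z, z ∉ ball x₀ ρ → g z = 0) {a b : ℝ} (ha : 0 < a)
    (hab : a ≤ b) (v : E) :
    Integrable (fun p : ℝ × E => heatExtension u p.1 p.2 * ⟪heatExtensionGrad g p.1 p.2, v⟫)
      ((volume.restrict (Set.Ioo a b)).prod volume) := by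
  have hu : AEStronglyMeasurable u volume := aestronglyMeasurable_of_growth hfw
  set d : ℕ := Module.finrank ℝ E with hd
  obtain ⟨CU, hCU0, hCU⟩ := exists_unif_bound_heatExtension hfw ha hab
  obtain ⟨CN, hCN0, hCN⟩ := exists_norm_heatExtensionGrad_le_of_support hρ hgM hgs (K + (d + 1)) ha hab
  haveI : IsFiniteMeasure (volume.restrict (Set.Ioo a b)) := ⟨by
    rw [Measure.restrict_apply_univ]; exact measure_Ioo_lt_top⟩
  have hwt : Integrable fun w : E => ((1 + ‖w - x₀‖) ^ (d + 1))⁻¹ :=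
    (integrable_inv_one_add_norm_pow (E := E)).comp_sub_right x₀
  have hmeas : AEStronglyMeasurable
      (fun p : ℝ × E => heatExtension u p.1 p.2 * ⟪heatExtensionGrad g p.1 p.2, v⟫)
      ((volume.restrict (Set.Ioo a b)).prod volume) :=
    ((measurable_heatExtension hu).mul
      ((measurable_heatExtensionGrad hgi.1).inner measurable_const)).aestronglyMeasurable
  refine Integrable.mono' ((integrable_const (1 : ℝ)).mul_prod
    (hwt.const_mul (CU * CN * ‖v‖ * (1 + ‖x₀‖) ^ K))) hmeas ?_
  refine (ae_fst_mem_Ioo a b).mono fun p ht => ?_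
  rcases p with ⟨t, w⟩
  have ht' : t ∈ Set.Icc a b := ⟨ht.1.le, ht.2.le⟩
  show ‖heatExtension u t w * ⟪heatExtensionGrad g t w, v⟫‖ ≤
    1 * (CU * CN * ‖v‖ * (1 + ‖x₀‖) ^ K * ((1 + ‖w - x₀‖) ^ (d + 1))⁻¹)
  rw [norm_mul, Real.norm_eq_abs, one_mul]
  have h1 := hCU t ht' w
  have h2 : ‖⟪heatExtensionGrad g t w, v⟫‖ ≤ CN * ((1 + ‖w - x₀‖) ^ (K + (d + 1)))⁻¹ * ‖v‖ :=
    (norm_inner_le_norm _ _).trans (mul_le_mul_of_nonneg_right (hCN t ht' w) (norm_nonneg _))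
  have hwt' := one_add_norm_pow_mul_inv_le w x₀ K (d + 1)
  calc |heatExtension u t w| * ‖⟪heatExtensionGrad g t w, v⟫‖
      ≤ (CU * (1 + ‖w‖) ^ K) * (CN * ((1 + ‖w - x₀‖) ^ (K + (d + 1)))⁻¹ * ‖v‖) :=
        mul_le_mul h1 h2 (norm_nonneg _) (by positivity)
    _ = CU * CN * ‖v‖ * ((1 + ‖w‖) ^ K * ((1 + ‖w - x₀‖) ^ (K + (d + 1)))⁻¹) := by ring
    _ ≤ CU * CN * ‖v‖ * ((1 + ‖x₀‖) ^ K * ((1 + ‖w - x₀‖) ^ (d + 1))⁻¹) := by gcongr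
    _ = CU * CN * ‖v‖ * (1 + ‖x₀‖) ^ K * ((1 + ‖w - x₀‖) ^ (d + 1))⁻¹ := by ring

/-- **The pairing identity on a finite time interval** (Koch–Tataru's representation
`fⁱ = ∂ᵢΔ⁻¹u` tested against an atom): for tempered `u`, an atom-like `g` supported in a ball,
`v ∈ E` and `0 < ε ≤ T`,
`∫ g ⟪∫_ε^T ∇e^{sΔ}u ds, v⟫ = -2 ∫∫_{(ε/2, T/2) × E} e^{tΔ}u ⟪∇e^{tΔ}g, v⟫`. [folklore] -/
theorem integral_mul_inner_setIntegral_heatExtensionGrad_eq {u g : E → ℝ} {K : ℕ}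
    (hfw : Integrable fun w => ((1 + ‖w‖) ^ K)⁻¹ * u w) (hgi : Integrable g) {x₀ : E} {ρ M : ℝ}
    (hρ : 0 < ρ) (hgM : ∀ z, |g z| ≤ M) (hgs : ∀ z, z ∉ ball x₀ ρ → g z = 0) {ε T : ℝ} (hε : 0 < ε)
    (hεT : ε ≤ T) (v : E) :
    ∫ x, g x * ⟪∫ s in Set.Ioo ε T, heatExtensionGrad u s x, v⟫ =
      -2 * ∫ p in Set.Ioo (ε / 2) (T / 2) ×ˢ (Set.univ : Set E),
        heatExtension u p.1 p.2 * ⟪heatExtensionGrad g p.1 p.2, v⟫ := by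
  have hu : AEStronglyMeasurable u volume := aestronglyMeasurable_of_growth hfw
  obtain ⟨C, hC0, hC⟩ := exists_unif_bound_heatExtensionGrad_of_growth hfw hε hεT
  set Bρ : ℝ := (1 + ‖x₀‖ + ρ) ^ K with hBρ
  haveI : IsFiniteMeasure (volume.restrict (Set.Ioo ε T)) := ⟨by
    rw [Measure.restrict_apply_univ]; exact measure_Ioo_lt_top⟩
  -- Step 1: inner product inside the time integral, then Fubini in `(x, s)`
  set F : E → ℝ → ℝ := fun x s => g x * ⟪heatExtensionGrad u s x, v⟫ with hF
  have hFint : Integrable (Function.uncurry F) (volume.prod (volume.restrict (Set.Ioo ε T))) := by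
    have hmeas : AEStronglyMeasurable (Function.uncurry F) (volume.prod (volume.restrict (Set.Ioo ε T))) := by
      have h1 : AEStronglyMeasurable (fun p : E × ℝ => g p.1) (volume.prod (volume.restrict (Set.Ioo ε T))) :=
        hgi.1.comp_fst
      have h2 : Measurable fun p : E × ℝ => ⟪heatExtensionGrad u p.2 p.1, v⟫ :=
        ((measurable_heatExtensionGrad hu).comp (measurable_snd.prodMk measurable_fst)).inner measurable_const
      exact h1.mul h2.aestronglyMeasurable
    refine Integrable.mono' ((hgi.norm.const_mul (Bρ * C * ‖v‖)).mul_prod (integrable_const (1 : ℝ)))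
      hmeas ?_
    have hae : ∀ᵐ p : E × ℝ ∂(volume.prod (volume.restrict (Set.Ioo ε T))), p.2 ∈ Set.Ioo ε T := by
      refine (Measure.ae_prod_iff_ae_ae ?_).mpr (Eventually.of_forall fun x => ae_restrict_mem measurableSet_Ioo)
      exact measurable_snd measurableSet_Ioo
    refine hae.mono fun p hp => ?_
    rcases p with ⟨x, s⟩
    show ‖g x * ⟪heatExtensionGrad u s x, v⟫‖ ≤ Bρ * C * ‖v‖ * ‖g x‖ * 1
    rw [norm_mul, Real.norm_eq_abs, Real.norm_eq_abs, mul_one]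
    have h1 : ‖⟪heatExtensionGrad u s x, v⟫‖ ≤ C * (1 + ‖x‖) ^ K * ‖v‖ :=
      (norm_inner_le_norm _ _).trans (mul_le_mul_of_nonneg_right (hC s ⟨hp.1.le, hp.2.le⟩ x) (norm_nonneg _))
    have hgx := abs_mul_one_add_norm_pow_le_of_support hgs K x
    calc |g x| * ‖⟪heatExtensionGrad u s x, v⟫‖ ≤ |g x| * (C * (1 + ‖x‖) ^ K * ‖v‖) := by gcongr
      _ = (|g x| * (1 + ‖x‖) ^ K) * (C * ‖v‖) := by ring
      _ ≤ (Bρ * |g x|) * (C * ‖v‖) := by gcongr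
      _ = Bρ * C * ‖v‖ * |g x| := by ring
  have hswap := integral_integral_swap hFint
  have step1 : ∫ x, g x * ⟪∫ s in Set.Ioo ε T, heatExtensionGrad u s x, v⟫ = ∫ x, ∫ s in Set.Ioo ε T, F x s := by
    refine integral_congr_ae (Eventually.of_forall fun x => ?_)
    show g x * ⟪∫ s in Set.Ioo ε T, heatExtensionGrad u s x, v⟫ = ∫ s in Set.Ioo ε T, g x * ⟪heatExtensionGrad u s x, v⟫
    rw [integral_const_mul, ← integral_real_inner_const (integrableOn_heatExtensionGrad_time hfw hε hεT x) v]
  rw [step1, hswap]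
  -- Step 2: for each `s`, move the kernel across and split the semigroup
  have step2 : ∫ s in Set.Ioo ε T, ∫ x, F x s =
      ∫ s in Set.Ioo ε T, -(∫ w, heatExtension u (s / 2) w * ⟪heatExtensionGrad g (s / 2) w, v⟫) := by
    refine setIntegral_congr_fun measurableSet_Ioo fun s hs => ?_
    have hs0 : 0 < s := hε.trans hs.1
    show ∫ x, g x * ⟪heatExtensionGrad u s x, v⟫ = _
    rw [integral_mul_inner_heatExtensionGrad_eq_neg hfw hgi hgs hs0 v,
      integral_mul_inner_heatExtensionGrad_eq_half hfw hgi hρ hgM hgs hs0 v]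
  rw [step2, integral_neg]
  -- Step 3: substitute `s = 2t`
  set H : ℝ → ℝ := fun t => ∫ w, heatExtension u t w * ⟪heatExtensionGrad g t w, v⟫ with hH
  have step3 : ∫ s in Set.Ioo ε T, H (s / 2) = 2 * ∫ t in Set.Ioo (ε / 2) (T / 2), H t := by
    rw [← integral_Ioc_eq_integral_Ioo, ← intervalIntegral.integral_of_le hεT,
      intervalIntegral.integral_comp_div H two_ne_zero, ← integral_Ioc_eq_integral_Ioo,
      ← intervalIntegral.integral_of_le (by linarith), smul_eq_mul]
  have eH : (fun s => ∫ w, heatExtension u (s / 2) w * ⟪heatExtensionGrad g (s / 2) w, v⟫) = fun s => H (s / 2) := by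
    funext s; rfl
  rw [eH, step3]
  -- Step 4: Fubini on the slab
  have step4 : ∫ t in Set.Ioo (ε / 2) (T / 2), H t =
      ∫ p in Set.Ioo (ε / 2) (T / 2) ×ˢ (Set.univ : Set E),
        heatExtension u p.1 p.2 * ⟪heatExtensionGrad g p.1 p.2, v⟫ := by
    rw [volume_restrict_prod_univ, integral_prod _
      (integrable_heatExtension_mul_inner_slab hfw hgi hρ hgM hgs (half_pos hε) (by linarith) v)]
  rw [step4]
  ring

end Pairing

/-! ## The total estimate for an abstract Carleson density against an atom -/

section Total

variable {E : Type*} [NormedAddCommGroup E] [InnerProductSpace ℝ E] [FiniteDimensional ℝ E]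
  [MeasurableSpace E] [BorelSpace E]

/-- **The tent estimate** for an abstract density `F` with Carleson boxes `≤ Γ R^d` over `x₀`:
`∫∫_{box} 2 F ‖∇e^{tΔ}g‖ ≤ Γ R^d + ½ M² |B(x₀, ρ)|`. [folklore] -/
theorem setLIntegral_box_two_mul_le_of_box {F : ℝ × E → ℝ≥0∞} {Γ : ℝ≥0∞} {g : E → ℝ} {x₀ : E} {ρ M : ℝ}
    (hF : ∀ R : ℝ, 0 < R → ∫⁻ p in Set.Ioo (0 : ℝ) (R ^ 2) ×ˢ ball x₀ R, F p ^ 2 ≤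
      Γ * ENNReal.ofReal (R ^ Module.finrank ℝ E))
    (hgi : Integrable g)
    (hgM : ∀ z, |g z| ≤ M) (hgs : ∀ z, z ∉ ball x₀ ρ → g z = 0) {R : ℝ} (hR : 0 < R) :
    ∫⁻ p in Set.Ioo (0 : ℝ) (R ^ 2) ×ˢ ball x₀ R,
        2 * (F p * ‖heatExtensionGrad g p.1 p.2‖ₑ) ≤
      Γ * ENNReal.ofReal (R ^ Module.finrank ℝ E) +
        ENNReal.ofReal (1 / 2) * (ENNReal.ofReal (M ^ 2) * volume (ball x₀ ρ)) := by
  have hpt : ∀ p : ℝ × E, 2 * (F p * ‖heatExtensionGrad g p.1 p.2‖ₑ) ≤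
      F p ^ 2 + ‖heatExtensionGrad g p.1 p.2‖ₑ ^ 2 := by
    intro p
    have := ENNReal.two_mul_mul_le_eps (F p) ‖heatExtensionGrad g p.1 p.2‖ₑ
      one_ne_zero ENNReal.one_ne_top
    simpa using this
  have hmeas : Measurable fun p : ℝ × E => ‖heatExtensionGrad g p.1 p.2‖ₑ ^ 2 :=
    (measurable_heatExtensionGrad hgi.1).enorm.pow_const 2
  calc ∫⁻ p in Set.Ioo (0 : ℝ) (R ^ 2) ×ˢ ball x₀ R,
        2 * (F p * ‖heatExtensionGrad g p.1 p.2‖ₑ)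
      ≤ ∫⁻ p in Set.Ioo (0 : ℝ) (R ^ 2) ×ˢ ball x₀ R,
          (F p ^ 2 + ‖heatExtensionGrad g p.1 p.2‖ₑ ^ 2) :=
        lintegral_mono fun p => hpt p
    _ = (∫⁻ p in Set.Ioo (0 : ℝ) (R ^ 2) ×ˢ ball x₀ R, F p ^ 2) +
          ∫⁻ p in Set.Ioo (0 : ℝ) (R ^ 2) ×ˢ ball x₀ R, ‖heatExtensionGrad g p.1 p.2‖ₑ ^ 2 :=
        lintegral_add_right _ hmeas
    _ ≤ Γ * ENNReal.ofReal (R ^ Module.finrank ℝ E) +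
          ∫⁻ t in Set.Ioi (0 : ℝ), ∫⁻ y, ‖heatExtensionGrad g t y‖ₑ ^ 2 := by
        gcongr
        · exact hF R hR
        · refine (lintegral_mono_set (Set.prod_mono Set.Ioo_subset_Ioi_self (Set.subset_univ _))).trans ?_
          refine (setLIntegral_prod_le _ _ _).trans (lintegral_mono fun t => ?_)
          exact (setLIntegral_le_lintegral _ _)
    _ ≤ _ := by
        gcongr
        exact (lintegral_Ioi_lintegral_enorm_heatExtensionGrad_sq_le hgi
          (memLp_two_of_support hgi hgM hgs)).trans (by gcongr; exact lintegral_enorm_sq_le_of_support hgM hgs)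

/-- **One annulus** for an abstract density `F` with Carleson boxes `≤ Γ R^d` over `x₀`. [folklore] -/
theorem setLIntegral_annulus_two_mul_le_of_box {F : ℝ × E → ℝ≥0∞} {Γ : ℝ≥0∞} {g : E → ℝ}
    (hgm : AEStronglyMeasurable g volume) {x₀ : E}
    (hF : ∀ R : ℝ, 0 < R → ∫⁻ p in Set.Ioo (0 : ℝ) (R ^ 2) ×ˢ ball x₀ R, F p ^ 2 ≤
      Γ * ENNReal.ofReal (R ^ Module.finrank ℝ E))
    {R' D ε : ℝ} (hR' : 0 < R') (hε : 0 < ε)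
    (hGg : ∀ p ∈ (Set.Ioo (0 : ℝ) ((2 * R') ^ 2) ×ˢ ball x₀ (2 * R')) \
        (Set.Ioo (0 : ℝ) (R' ^ 2) ×ˢ ball x₀ R'),
      ‖heatExtensionGrad g p.1 p.2‖ ≤ D * (R' ^ (Module.finrank ℝ E + 2))⁻¹) :
    ∫⁻ p in (Set.Ioo (0 : ℝ) ((2 * R') ^ 2) ×ˢ ball x₀ (2 * R')) \
        (Set.Ioo (0 : ℝ) (R' ^ 2) ×ˢ ball x₀ R'),
        2 * (F p * ‖heatExtensionGrad g p.1 p.2‖ₑ) ≤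
      ENNReal.ofReal ε * (Γ * ENNReal.ofReal ((2 * R') ^ Module.finrank ℝ E)) +
        (ENNReal.ofReal ε)⁻¹ * (ENNReal.ofReal ((D * (R' ^ (Module.finrank ℝ E + 2))⁻¹) ^ 2) *
          (ENNReal.ofReal ((2 * R') ^ 2) * volume (ball x₀ (2 * R')))) := by
  set A := (Set.Ioo (0 : ℝ) ((2 * R') ^ 2) ×ˢ ball x₀ (2 * R')) \
    (Set.Ioo (0 : ℝ) (R' ^ 2) ×ˢ ball x₀ R') with hA
  have hAm : MeasurableSet A :=
    (measurableSet_Ioo.prod measurableSet_ball).diff (measurableSet_Ioo.prod measurableSet_ball)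
  have hε0 : ENNReal.ofReal ε ≠ 0 := by rw [ne_eq, ENNReal.ofReal_eq_zero, not_le]; exact hε
  have hpt : ∀ p : ℝ × E, 2 * (F p * ‖heatExtensionGrad g p.1 p.2‖ₑ) ≤
      ENNReal.ofReal ε * F p ^ 2 +
        (ENNReal.ofReal ε)⁻¹ * ‖heatExtensionGrad g p.1 p.2‖ₑ ^ 2 := fun p =>
    ENNReal.two_mul_mul_le_eps _ _ hε0 ENNReal.ofReal_ne_top
  calc ∫⁻ p in A, 2 * (F p * ‖heatExtensionGrad g p.1 p.2‖ₑ)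
      ≤ ∫⁻ p in A, (ENNReal.ofReal ε * F p ^ 2 +
          (ENNReal.ofReal ε)⁻¹ * ‖heatExtensionGrad g p.1 p.2‖ₑ ^ 2) := lintegral_mono fun p => hpt p
    _ = (∫⁻ p in A, ENNReal.ofReal ε * F p ^ 2) +
          ∫⁻ p in A, (ENNReal.ofReal ε)⁻¹ * ‖heatExtensionGrad g p.1 p.2‖ₑ ^ 2 :=
        lintegral_add_right _ (((measurable_heatExtensionGrad hgm).enorm.pow_const 2).const_mul _)
    _ = ENNReal.ofReal ε * (∫⁻ p in A, F p ^ 2) +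
          (ENNReal.ofReal ε)⁻¹ * ∫⁻ p in A, ‖heatExtensionGrad g p.1 p.2‖ₑ ^ 2 := by
        rw [lintegral_const_mul' _ _ ENNReal.ofReal_ne_top,
          lintegral_const_mul' _ _ (ENNReal.inv_ne_top.mpr hε0)]
    _ ≤ ENNReal.ofReal ε * (Γ * ENNReal.ofReal ((2 * R') ^ Module.finrank ℝ E)) +
          (ENNReal.ofReal ε)⁻¹ * (ENNReal.ofReal ((D * (R' ^ (Module.finrank ℝ E + 2))⁻¹) ^ 2) * volume A) := by
        gcongr
        · exact (lintegral_mono_set Set.sdiff_subset).trans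
            (hF (2 * R') (by positivity))
        · rw [← setLIntegral_const]
          refine setLIntegral_mono' hAm fun p hp => ?_
          rw [← ofReal_norm, ← ENNReal.ofReal_pow (norm_nonneg _)]
          exact ENNReal.ofReal_le_ofReal (pow_le_pow_left₀ (norm_nonneg _) (hGg p hp) 2)
    _ ≤ _ := by
        gcongr
        calc volume A ≤ volume (Set.Ioo (0 : ℝ) ((2 * R') ^ 2) ×ˢ ball x₀ (2 * R')) :=
              measure_mono Set.sdiff_subset
          _ = ENNReal.ofReal ((2 * R') ^ 2) * volume (ball x₀ (2 * R')) := by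
              rw [Measure.volume_eq_prod, Measure.prod_prod, Real.volume_Ioo, sub_zero]

/-- **The total estimate for an abstract Carleson density** (Stein, *Harmonic Analysis*, IV §4.4,
tent plus dyadic annuli): there are `A₁, A₂ = A(E)` such that for every measurable
`F : (0,∞) × E → [0,∞]` whose Carleson boxes over `x₀` are `≤ Γ R^d` and every mean-zero `g`
with `|g| ≤ M` supported in `B(x₀, ρ)`,
`∫∫_{(0,∞) × E} 2 F ‖∇e^{tΔ}g‖ ≤ (A₁ Γ + A₂ M²) ρ^d`. [folklore] -/
theorem exists_lintegral_two_mul_mul_enorm_le_of_box :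
    ∃ A₁ A₂ : ℝ, 0 ≤ A₁ ∧ 0 ≤ A₂ ∧ ∀ {F : ℝ × E → ℝ≥0∞} {Γ : ℝ≥0∞} {g : E → ℝ} {x₀ : E} {ρ M : ℝ},
      (∀ R : ℝ, 0 < R → ∫⁻ p in Set.Ioo (0 : ℝ) (R ^ 2) ×ˢ ball x₀ R, F p ^ 2 ≤
        Γ * ENNReal.ofReal (R ^ Module.finrank ℝ E)) →
      Γ < ∞ → Integrable g → 0 < ρ → (∀ z, |g z| ≤ M) →
      (∀ z, z ∉ ball x₀ ρ → g z = 0) → (∫ z, g z = 0) →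
      ∫⁻ p in Set.Ioi (0 : ℝ) ×ˢ (Set.univ : Set E),
          2 * (F p * ‖heatExtensionGrad g p.1 p.2‖ₑ) ≤
        ENNReal.ofReal ((A₁ * Γ.toReal + A₂ * M ^ 2) * ρ ^ Module.finrank ℝ E) := by
  obtain ⟨C, hC0, hC⟩ := exists_norm_heatExtensionGrad_le_annulus (E := E)
  set V₁ : ℝ := volume.real (ball (0 : E) 1) with hV₁
  have hV₁0 : 0 ≤ V₁ := measureReal_nonneg
  refine ⟨2 ^ (Module.finrank ℝ E + 1), 1 / 2 * V₁ + 2 ^ (Module.finrank ℝ E + 2) * V₁ ^ 3 * C ^ 2,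
    by positivity, by positivity, ?_⟩
  intro F Γ g x₀ ρ M hF hγ hgi hρ hgM hgs hg0
  have hM : 0 ≤ M := (abs_nonneg _).trans (hgM x₀)
  set γr : ℝ := Γ.toReal with hγr
  have hγr0 : 0 ≤ γr := ENNReal.toReal_nonneg
  have hγe : Γ = ENNReal.ofReal γr := (ENNReal.ofReal_toReal hγ.ne).symm
  -- the dyadic boxes
  set R : ℝ := 2 * ρ with hR
  have hR0 : 0 < R := by positivity
  set Rk : ℕ → ℝ := fun k => 2 ^ k * R with hRk
  have hRk0 : ∀ k, 0 < Rk k := fun k => by positivity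
  have hRk_succ : ∀ k, Rk (k + 1) = 2 * Rk k := fun k => by simp only [hRk, pow_succ]; ring
  set box : ℕ → Set (ℝ × E) := fun k => Set.Ioo (0 : ℝ) (Rk k ^ 2) ×ˢ ball x₀ (Rk k) with hbox
  -- covering
  have hcover : Set.Ioi (0 : ℝ) ×ˢ (Set.univ : Set E) ⊆ box 0 ∪ ⋃ k, (box (k + 1) \ box k) :=
    (Ioi_prod_univ_subset_iUnion_box x₀ hR0).trans (iUnion_subset_first_union_iUnion_diff box)
  -- tent
  have htent : ∫⁻ p in box 0, 2 * (F p * ‖heatExtensionGrad g p.1 p.2‖ₑ) ≤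
      ENNReal.ofReal ((2 ^ Module.finrank ℝ E * γr + 1 / 2 * V₁ * M ^ 2) * ρ ^ Module.finrank ℝ E) := by
    have h := setLIntegral_box_two_mul_le_of_box hF hgi hgM hgs (hRk0 0)
    refine h.trans (le_of_eq ?_)
    rw [hγe, volume_ball_eq_ofReal x₀ hρ, ← hV₁,
      ← ENNReal.ofReal_mul hγr0, ← ENNReal.ofReal_mul (sq_nonneg M), ← ENNReal.ofReal_mul (by norm_num),
      ← ENNReal.ofReal_add (by positivity) (by positivity)]
    congr 1
    simp only [hRk, hR, pow_zero, one_mul, mul_pow]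
    ring
  -- annuli
  have hann : ∀ k, ∫⁻ p in box (k + 1) \ box k,
      2 * (F p * ‖heatExtensionGrad g p.1 p.2‖ₑ) ≤
      ENNReal.ofReal ((2 ^ Module.finrank ℝ E / 2 * γr + 2 ^ (Module.finrank ℝ E + 1) * V₁ ^ 3 * C ^ 2 * M ^ 2) *
        ρ ^ Module.finrank ℝ E) * (2⁻¹) ^ k := by
    intro k
    set D : ℝ := C * M * volume.real (ball x₀ ρ) * ρ with hD
    have hD0 : 0 ≤ D := by positivity
    set ε : ℝ := (ρ / Rk k) ^ (Module.finrank ℝ E + 1) with hε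
    have hε0 : 0 < ε := by positivity
    have hGg : ∀ p ∈ (Set.Ioo (0 : ℝ) ((2 * Rk k) ^ 2) ×ˢ ball x₀ (2 * Rk k)) \
        (Set.Ioo (0 : ℝ) (Rk k ^ 2) ×ˢ ball x₀ (Rk k)),
        ‖heatExtensionGrad g p.1 p.2‖ ≤ D * (Rk k ^ (Module.finrank ℝ E + 2))⁻¹ := by
      rintro ⟨t, y⟩ ⟨⟨ht, hy⟩, hnot⟩
      simp only [Set.mem_Ioo] at ht
      have hρR : 2 * ρ ≤ Rk k := by
        simp only [hRk, hR]
        have : (1 : ℝ) ≤ 2 ^ k := one_le_pow₀ (by norm_num)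
        nlinarith
      have hcase : Rk k ^ 2 ≤ t ∨ Rk k ≤ ‖y - x₀‖ := by
        by_contra h
        rw [not_or, not_le, not_le] at h
        exact hnot ⟨⟨ht.1, h.1⟩, mem_ball_iff_norm.mpr h.2⟩
      exact hC hρ hgM hgs hg0 hgi hρR ht.1 hy hcase
    have h := setLIntegral_annulus_two_mul_le_of_box hgi.1 hF (hRk0 k) hε0 hGg
    rw [show box (k + 1) = Set.Ioo (0 : ℝ) ((2 * Rk k) ^ 2) ×ˢ ball x₀ (2 * Rk k) by
      simp only [hbox, hRk_succ]]
    refine h.trans (le_of_eq ?_)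
    have hVρ : volume.real (ball x₀ ρ) = ρ ^ Module.finrank ℝ E * V₁ := by
      rw [measureReal_def, volume_ball_eq_ofReal x₀ hρ, ENNReal.toReal_ofReal (by positivity)]
    rw [hγe, volume_ball_eq_ofReal x₀ (by positivity : (0 : ℝ) < 2 * Rk k), ← hV₁,
      ← ENNReal.ofReal_inv_of_pos hε0,
      ← ENNReal.ofReal_mul hγr0, ← ENNReal.ofReal_mul hε0.le,
      ← ENNReal.ofReal_mul (by positivity), ← ENNReal.ofReal_mul (by positivity),
      ← ENNReal.ofReal_mul (by positivity), ← ENNReal.ofReal_add (by positivity) (by positivity),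
      show ((2 : ℝ≥0∞)⁻¹) ^ k = ENNReal.ofReal ((2⁻¹) ^ k) by
        rw [ENNReal.ofReal_pow (by norm_num), ENNReal.ofReal_inv_of_pos two_pos, ENNReal.ofReal_ofNat],
      ← ENNReal.ofReal_mul (by positivity)]
    congr 1
    rw [hD, hVρ, hε]
    exact annulus_algebra (Module.finrank ℝ E) k γr C M V₁ hρ (by simp only [hRk, hR])
  -- sum
  calc ∫⁻ p in Set.Ioi (0 : ℝ) ×ˢ (Set.univ : Set E),
        2 * (F p * ‖heatExtensionGrad g p.1 p.2‖ₑ)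
      ≤ ∫⁻ p in box 0 ∪ ⋃ k, (box (k + 1) \ box k),
          2 * (F p * ‖heatExtensionGrad g p.1 p.2‖ₑ) :=
        lintegral_mono_set hcover
    _ ≤ (∫⁻ p in box 0, 2 * (F p * ‖heatExtensionGrad g p.1 p.2‖ₑ)) +
          ∫⁻ p in ⋃ k, (box (k + 1) \ box k),
            2 * (F p * ‖heatExtensionGrad g p.1 p.2‖ₑ) :=
        lintegral_union_le _ _ _
    _ ≤ ENNReal.ofReal ((2 ^ Module.finrank ℝ E * γr + 1 / 2 * V₁ * M ^ 2) * ρ ^ Module.finrank ℝ E) +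
          ∑' k, ∫⁻ p in box (k + 1) \ box k,
            2 * (F p * ‖heatExtensionGrad g p.1 p.2‖ₑ) :=
        add_le_add htent (lintegral_iUnion_le _ _)
    _ ≤ ENNReal.ofReal ((2 ^ Module.finrank ℝ E * γr + 1 / 2 * V₁ * M ^ 2) * ρ ^ Module.finrank ℝ E) +
          ∑' k : ℕ, ENNReal.ofReal ((2 ^ Module.finrank ℝ E / 2 * γr +
            2 ^ (Module.finrank ℝ E + 1) * V₁ ^ 3 * C ^ 2 * M ^ 2) * ρ ^ Module.finrank ℝ E) * (2⁻¹ : ℝ≥0∞) ^ k := by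
        gcongr with k
        exact hann k
    _ = ENNReal.ofReal ((2 ^ Module.finrank ℝ E * γr + 1 / 2 * V₁ * M ^ 2) * ρ ^ Module.finrank ℝ E) +
          ENNReal.ofReal ((2 ^ Module.finrank ℝ E / 2 * γr +
            2 ^ (Module.finrank ℝ E + 1) * V₁ ^ 3 * C ^ 2 * M ^ 2) * ρ ^ Module.finrank ℝ E) * 2 := by
        rw [ENNReal.tsum_mul_left, ENNReal.tsum_geometric, ENNReal.one_sub_inv_two, inv_inv]
    _ = ENNReal.ofReal ((2 ^ (Module.finrank ℝ E + 1) * γr +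
          (1 / 2 * V₁ + 2 ^ (Module.finrank ℝ E + 2) * V₁ ^ 3 * C ^ 2) * M ^ 2) * ρ ^ Module.finrank ℝ E) := by
        rw [← ENNReal.ofReal_ofNat 2, ← ENNReal.ofReal_mul' (by norm_num),
          ← ENNReal.ofReal_add (by positivity) (by positivity)]
        congr 1
        ring

/-- **The total estimate for the caloric extension of `u`**: with `γ = eCarlesonNorm u < ∞` and a
mean-zero atom-like `g`, `∫∫_{(0,∞) × E} 2 |e^{tΔ}u| ‖∇e^{tΔ}g‖ ≤ (A₁ γ + A₂ M²) ρ^d`. [folklore] -/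
theorem exists_lintegral_two_mul_enorm_heatExtension_mul_le :
    ∃ A₁ A₂ : ℝ, 0 ≤ A₁ ∧ 0 ≤ A₂ ∧ ∀ {u g : E → ℝ} {x₀ : E} {ρ M : ℝ},
      AEStronglyMeasurable u volume → eCarlesonNorm u < ∞ → Integrable g → 0 < ρ → (∀ z, |g z| ≤ M) →
      (∀ z, z ∉ ball x₀ ρ → g z = 0) → (∫ z, g z = 0) →
      ∫⁻ p in Set.Ioi (0 : ℝ) ×ˢ (Set.univ : Set E),
          2 * (‖heatExtension u p.1 p.2‖ₑ * ‖heatExtensionGrad g p.1 p.2‖ₑ) ≤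
        ENNReal.ofReal ((A₁ * (eCarlesonNorm u).toReal + A₂ * M ^ 2) * ρ ^ Module.finrank ℝ E) := by
  obtain ⟨A₁, A₂, hA₁, hA₂, hA⟩ := exists_lintegral_two_mul_mul_enorm_le_of_box (E := E)
  refine ⟨A₁, A₂, hA₁, hA₂, @fun u g x₀ ρ M hu hγ hgi hρ hgM hgs hg0 => ?_⟩
  exact hA (F := fun p => ‖heatExtension u p.1 p.2‖ₑ)
    (fun R hR => lintegral_prod_ball_le_eCarlesonNorm u x₀ hR subset_rfl) hγ hgi hρ hgM hgs hg0

/-- `x ^ (1/2)` algebra: `(a * b) ^ (1/2) = a ^ (1/2) * b ^ (1/2)` in `ℝ≥0∞`. [folklore] -/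
theorem ennreal_mul_rpow_half (a b : ℝ≥0∞) :
    (a * b) ^ (1 / 2 : ℝ) = a ^ (1 / 2 : ℝ) * b ^ (1 / 2 : ℝ) :=
  ENNReal.mul_rpow_of_nonneg _ _ (by norm_num)

/-- `ofReal x ^ (1/2) = ofReal (√x)`. [folklore] -/
theorem ennreal_ofReal_rpow_half {x : ℝ} (hx : 0 ≤ x) :
    ENNReal.ofReal x ^ (1 / 2 : ℝ) = ENNReal.ofReal (Real.sqrt x) := by
  rw [ENNReal.ofReal_rpow_of_nonneg hx (by norm_num), Real.sqrt_eq_rpow]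

/-- Cauchy–Schwarz for `lintegral` with exponent written as `x ^ 2` and `(·) ^ (1/2)`. [folklore] -/
theorem lintegral_mul_le_rpow_half_mul_rpow_half {α : Type*} [MeasurableSpace α] (μ : Measure α) {f g : α → ℝ≥0∞}
    (hf : AEMeasurable f μ) (hg : AEMeasurable g μ) :
    ∫⁻ a, f a * g a ∂μ ≤ (∫⁻ a, f a ^ 2 ∂μ) ^ (1 / 2 : ℝ) * (∫⁻ a, g a ^ 2 ∂μ) ^ (1 / 2 : ℝ) := by
  have h := ENNReal.lintegral_mul_le_Lp_mul_Lq μ Real.HolderConjugate.two_two hf hg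
  have h2 : ∀ x : ℝ≥0∞, x ^ (2 : ℝ) = x ^ 2 := fun x => by
    rw [show (2 : ℝ) = ((2 : ℕ) : ℝ) by norm_num, ENNReal.rpow_natCast]
  simp only [Pi.mul_apply, h2] at h
  exact h

/-- **The small-time estimate** (the `L²`-Cauchy property of `∫_ε ∇e^{sΔ}u ds` in disguise): there
is `C = C(E)` such that for `u` measurable with `γ = eCarlesonNorm u`, `g ∈ L²` vanishing off
`B(x₀, ρ)` and `0 < a ≤ ρ²`,
`∫∫_{(0,a) × E} |e^{tΔ}u| ‖∇e^{tΔ}g‖ ≤ ((∫∫_{(0,a) × B(x₀,2ρ)} |e^{tΔ}u|²)^{1/2} + C √a ρ^{d/2-1} γ^{1/2}) ‖g‖₂`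
(Cauchy–Schwarz on the tent with the energy inequality; on the dyadic shells the uniform kernel
decay `‖∇K_t(w)‖ ≤ C ‖w‖^{-(d+1)}` and one Carleson box each). [folklore] -/
theorem exists_lintegral_small_time_le :
    ∃ C : ℝ, 0 ≤ C ∧ ∀ {u g : E → ℝ} {x₀ : E} {ρ a : ℝ},
      AEStronglyMeasurable u volume → Integrable g → MemLp g 2 volume → 0 < ρ →
      (∀ z, z ∉ ball x₀ ρ → g z = 0) → 0 < a → a ≤ ρ ^ 2 →
      ∫⁻ p in Set.Ioo (0 : ℝ) a ×ˢ (Set.univ : Set E),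
          ‖heatExtension u p.1 p.2‖ₑ * ‖heatExtensionGrad g p.1 p.2‖ₑ ≤
        ((∫⁻ p in Set.Ioo (0 : ℝ) a ×ˢ ball x₀ (2 * ρ), ‖heatExtension u p.1 p.2‖ₑ ^ 2) ^ (1 / 2 : ℝ) +
          ENNReal.ofReal (C * Real.sqrt a * Real.sqrt (ρ ^ Module.finrank ℝ E) / ρ) *
            eCarlesonNorm u ^ (1 / 2 : ℝ)) *
          (∫⁻ z, ‖g z‖ₑ ^ 2) ^ (1 / 2 : ℝ) := by
  set d : ℕ := Module.finrank ℝ E with hd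
  set CK : ℝ := 2 * (d + 2).factorial with hCK
  set V₁ : ℝ := volume.real (ball (0 : E) 1) with hV₁
  have hV₁0 : 0 ≤ V₁ := measureReal_nonneg
  refine ⟨2 * CK * V₁ * 4 ^ d, by positivity, @fun u g x₀ ρ a hu hgi hg2 hρ hgs ha haρ => ?_⟩
  set γ := eCarlesonNorm u with hγ
  set Uₑ : ℝ × E → ℝ≥0∞ := fun p => ‖heatExtension u p.1 p.2‖ₑ with hU
  set Gₑ : ℝ × E → ℝ≥0∞ := fun p => ‖heatExtensionGrad g p.1 p.2‖ₑ with hG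
  have hUm : Measurable Uₑ := (measurable_heatExtension hu).enorm
  have hGm : Measurable Gₑ := (measurable_heatExtensionGrad hgi.1).enorm
  set L₁ : ℝ≥0∞ := ∫⁻ z, ‖g z‖ₑ with hL₁
  set L₂ : ℝ≥0∞ := (∫⁻ z, ‖g z‖ₑ ^ 2) ^ (1 / 2 : ℝ) with hL₂
  set r : ℝ := 2 * ρ with hr
  have hr0 : 0 < r := by positivity
  -- boxes of all shells contain the short time interval
  have hIoo : ∀ k : ℕ, Set.Ioo (0 : ℝ) a ⊆ Set.Ioo 0 ((2 ^ (k + 1) * r) ^ 2) := by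
    intro k t ht
    refine ⟨ht.1, lt_of_lt_of_le ht.2 (haρ.trans ?_)⟩
    have h1 : ρ ≤ 2 ^ (k + 1) * r := by
      rw [hr]
      have : (1 : ℝ) ≤ 2 ^ (k + 1) := one_le_pow₀ (by norm_num)
      nlinarith
    exact pow_le_pow_left₀ hρ.le h1 2
  -- `‖g‖₁ ≤ √(V₁ ρ^d) ‖g‖₂`
  have hL₁ : L₁ ≤ ENNReal.ofReal (Real.sqrt (V₁ * ρ ^ d)) * L₂ := by
    have h1 : L₁ = ∫⁻ z in ball x₀ ρ, ‖g z‖ₑ * 1 := by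
      rw [hL₁, ← lintegral_indicator measurableSet_ball]
      refine lintegral_congr fun z => ?_
      by_cases hz : z ∈ ball x₀ ρ
      · rw [Set.indicator_of_mem hz, mul_one]
      · rw [Set.indicator_of_notMem hz, hgs z hz]; simp
    rw [h1]
    refine (lintegral_mul_le_rpow_half_mul_rpow_half (volume.restrict (ball x₀ ρ)) hgi.1.enorm.restrict
      aemeasurable_const).trans ?_
    rw [lintegral_const, one_pow, one_mul, Measure.restrict_apply_univ, volume_ball_eq_ofReal x₀ hρ, ← hV₁,
      ← hd, ennreal_ofReal_rpow_half (mul_nonneg (by positivity) hV₁0), mul_comm,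
      show ρ ^ d * V₁ = V₁ * ρ ^ d by ring, hL₂]
    gcongr
    exact Measure.restrict_le_self
  -- tent: Cauchy–Schwarz and the energy inequality
  have htent : ∫⁻ p in Set.Ioo (0 : ℝ) a ×ˢ ball x₀ r, Uₑ p * Gₑ p ≤
      (∫⁻ p in Set.Ioo (0 : ℝ) a ×ˢ ball x₀ r, Uₑ p ^ 2) ^ (1 / 2 : ℝ) * L₂ := by
    refine (lintegral_mul_le_rpow_half_mul_rpow_half _ hUm.aemeasurable hGm.aemeasurable).trans ?_
    rw [hL₂]
    gcongr
    -- `∫∫_{tent} ‖∇e^{tΔ}g‖² ≤ ∫₀^∞∫ ‖∇e^{tΔ}g‖² ≤ ½ ‖g‖₂² ≤ ‖g‖₂²`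
    calc ∫⁻ p in Set.Ioo (0 : ℝ) a ×ˢ ball x₀ r, Gₑ p ^ 2
        ≤ ∫⁻ t in Set.Ioi (0 : ℝ), ∫⁻ y, Gₑ (t, y) ^ 2 := by
          refine (lintegral_mono_set (Set.prod_mono Set.Ioo_subset_Ioi_self (Set.subset_univ _))).trans ?_
          refine (setLIntegral_prod_le _ _ _).trans (lintegral_mono fun t => ?_)
          exact setLIntegral_le_lintegral _ _
      _ ≤ ENNReal.ofReal (1 / 2) * ∫⁻ y, ‖g y‖ₑ ^ 2 :=
          lintegral_Ioi_lintegral_enorm_heatExtensionGrad_sq_le hgi hg2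
      _ ≤ 1 * ∫⁻ y, ‖g y‖ₑ ^ 2 := by gcongr; exact ENNReal.ofReal_le_one.mpr (by norm_num)
      _ = _ := one_mul _
  -- shells
  have hshell : ∀ k : ℕ,
      ∫⁻ p in Set.Ioo (0 : ℝ) a ×ˢ (ball x₀ (2 ^ (k + 1) * r) \ ball x₀ (2 ^ k * r)), Uₑ p * Gₑ p ≤
        γ ^ (1 / 2 : ℝ) * L₁ * ENNReal.ofReal (CK * Real.sqrt a * Real.sqrt V₁ * 4 ^ d / ρ * (1 / 2 : ℝ) ^ k) := by
    intro k
    set A : Set (ℝ × E) := Set.Ioo (0 : ℝ) a ×ˢ (ball x₀ (2 ^ (k + 1) * r) \ ball x₀ (2 ^ k * r)) with hA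
    have hAm : MeasurableSet A := measurableSet_Ioo.prod (measurableSet_ball.diff measurableSet_ball)
    set Dk : ℝ := CK * ((2 ^ k * ρ) ^ (d + 1))⁻¹ with hDk
    have hDk0 : 0 ≤ Dk := by positivity
    -- the pointwise bound on the shell
    have hGk : ∀ p ∈ A, Gₑ p ≤ L₁ * ENNReal.ofReal Dk := by
      rintro ⟨t, y⟩ ⟨ht, hy, hynot⟩
      have ht0 : 0 < t := ht.1
      have hker : ∀ z, ‖g z‖ₑ * ‖heatKernelGrad t (y - z)‖ₑ ≤ ‖g z‖ₑ * ENNReal.ofReal Dk := by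
        intro z
        by_cases hz : z ∈ ball x₀ ρ
        · gcongr
          rw [← ofReal_norm]
          refine ENNReal.ofReal_le_ofReal ?_
          -- `‖y - z‖ ≥ 2^k ρ`
          have hyz : 2 ^ k * ρ ≤ ‖y - z‖ := by
            have h1 : 2 ^ k * r ≤ ‖y - x₀‖ := by
              rw [mem_ball_iff_norm, not_lt] at hynot; exact hynot
            have h2 : ‖z - x₀‖ < ρ := mem_ball_iff_norm.mp hz
            have h3 := norm_sub_norm_le (y - x₀) (z - x₀)
            rw [sub_sub_sub_cancel_right] at h3
            have h4 : (1 : ℝ) ≤ 2 ^ k := one_le_pow₀ (by norm_num)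
            rw [hr] at h1
            nlinarith
          have hyz0 : 0 < ‖y - z‖ := lt_of_lt_of_le (by positivity) hyz
          have h5 := norm_pow_mul_norm_heatKernelGrad_le ht0 (y - z)
          rw [← hd, ← hCK] at h5
          have h6 : ‖heatKernelGrad t (y - z)‖ ≤ CK * (‖y - z‖ ^ (d + 1))⁻¹ := by
            rw [← div_eq_mul_inv, le_div_iff₀ (by positivity), mul_comm]; exact h5
          refine h6.trans ?_
          rw [hDk]
          gcongr
        · rw [hgs z hz]; simp
      calc Gₑ (t, y) = ‖∫ z, g z • heatKernelGrad t (y - z)‖ₑ := rfl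
        _ ≤ ∫⁻ z, ‖g z • heatKernelGrad t (y - z)‖ₑ := enorm_integral_le_lintegral_enorm _
        _ ≤ ∫⁻ z, ‖g z‖ₑ * ENNReal.ofReal Dk := lintegral_mono fun z => by rw [enorm_smul]; exact hker z
        _ = L₁ * ENNReal.ofReal Dk := by rw [lintegral_mul_const'' _ hgi.1.enorm]
    -- Cauchy–Schwarz against `1` for `Uₑ` on the shell slab
    have hU1 : ∫⁻ p in A, Uₑ p ≤ (γ * ENNReal.ofReal ((2 ^ (k + 1) * r) ^ d)) ^ (1 / 2 : ℝ) *
        (volume A) ^ (1 / 2 : ℝ) := by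
      have h := lintegral_mul_le_rpow_half_mul_rpow_half ((volume : Measure (ℝ × E)).restrict A)
        hUm.aemeasurable aemeasurable_const (g := fun _ => 1)
      simp only [mul_one, one_pow, one_mul, lintegral_const, Measure.restrict_apply_univ] at h
      refine h.trans ?_
      gcongr
      refine (lintegral_mono_set (Set.prod_mono (hIoo k) sdiff_le)).trans ?_
      exact lintegral_prod_ball_le_eCarlesonNorm u x₀ (by positivity) subset_rfl
    have hvolA : volume A ≤ ENNReal.ofReal (a * ((2 ^ (k + 1) * r) ^ d * V₁)) := by
      calc volume A ≤ volume (Set.Ioo (0 : ℝ) a ×ˢ ball x₀ (2 ^ (k + 1) * r)) :=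
            measure_mono (Set.prod_mono subset_rfl sdiff_le)
        _ = ENNReal.ofReal (a * ((2 ^ (k + 1) * r) ^ d * V₁)) := by
            rw [Measure.volume_eq_prod, Measure.prod_prod, Real.volume_Ioo, sub_zero,
              volume_ball_eq_ofReal x₀ (by positivity), ← hV₁, ← ENNReal.ofReal_mul ha.le]
    calc ∫⁻ p in A, Uₑ p * Gₑ p ≤ ∫⁻ p in A, Uₑ p * (L₁ * ENNReal.ofReal Dk) :=
          setLIntegral_mono' hAm fun p hp => by gcongr; exact hGk p hp
      _ = (∫⁻ p in A, Uₑ p) * (L₁ * ENNReal.ofReal Dk) := by rw [lintegral_mul_const _ hUm]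
      _ ≤ ((γ * ENNReal.ofReal ((2 ^ (k + 1) * r) ^ d)) ^ (1 / 2 : ℝ) *
            (ENNReal.ofReal (a * ((2 ^ (k + 1) * r) ^ d * V₁))) ^ (1 / 2 : ℝ)) * (L₁ * ENNReal.ofReal Dk) := by
          gcongr
          exact hU1.trans (by gcongr)
      _ = γ ^ (1 / 2 : ℝ) * L₁ * (ENNReal.ofReal (Real.sqrt ((2 ^ (k + 1) * r) ^ d)) *
            ENNReal.ofReal (Real.sqrt (a * ((2 ^ (k + 1) * r) ^ d * V₁))) * ENNReal.ofReal Dk) := by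
          rw [ennreal_mul_rpow_half, ennreal_ofReal_rpow_half (by positivity),
            ennreal_ofReal_rpow_half (mul_nonneg ha.le (mul_nonneg (by positivity) hV₁0))]
          ring
      _ = γ ^ (1 / 2 : ℝ) * L₁ * ENNReal.ofReal (CK * Real.sqrt a * Real.sqrt V₁ * 4 ^ d / ρ * (1 / 2 : ℝ) ^ k) := by
          congr 1
          rw [← ENNReal.ofReal_mul (Real.sqrt_nonneg _), ← ENNReal.ofReal_mul (mul_nonneg (Real.sqrt_nonneg _) (Real.sqrt_nonneg _))]
          congr 1
          -- the shell algebra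
          have hsq : Real.sqrt ((2 ^ (k + 1) * r) ^ d) * Real.sqrt (a * ((2 ^ (k + 1) * r) ^ d * V₁)) =
              Real.sqrt a * Real.sqrt V₁ * (2 ^ (k + 1) * r) ^ d := by
            rw [Real.sqrt_mul ha.le, Real.sqrt_mul (by positivity)]
            have : Real.sqrt ((2 ^ (k + 1) * r) ^ d) * Real.sqrt ((2 ^ (k + 1) * r) ^ d) = (2 ^ (k + 1) * r) ^ d :=
              Real.mul_self_sqrt (by positivity)
            calc Real.sqrt ((2 ^ (k + 1) * r) ^ d) * (Real.sqrt a * (Real.sqrt ((2 ^ (k + 1) * r) ^ d) * Real.sqrt V₁))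
                = Real.sqrt a * Real.sqrt V₁ * (Real.sqrt ((2 ^ (k + 1) * r) ^ d) * Real.sqrt ((2 ^ (k + 1) * r) ^ d)) := by
                  ring
              _ = _ := by rw [this]
          have key : Real.sqrt a * Real.sqrt V₁ * (2 ^ (k + 1) * r) ^ d * Dk =
              CK * Real.sqrt a * Real.sqrt V₁ * 4 ^ d / ρ * (1 / 2 : ℝ) ^ k := by
            rw [hDk, hr, show (2 : ℝ) ^ (k + 1) * (2 * ρ) = 4 * (2 ^ k * ρ) by ring, mul_pow,
              mul_pow ((2 : ℝ) ^ k) ρ, mul_pow ((2 : ℝ) ^ k) ρ, pow_succ ((2 : ℝ) ^ k), pow_succ ρ, one_div, inv_pow]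
            have hρ' : ρ ≠ 0 := hρ.ne'
            have h2k : (2 : ℝ) ^ k ≠ 0 := by positivity
            have h2kd : ((2 : ℝ) ^ k) ^ d ≠ 0 := by positivity
            have hρd : ρ ^ d ≠ 0 := by positivity
            field_simp
          rw [hsq, key]
  -- sum the shells
  have hsum : ∑' k : ℕ, ∫⁻ p in Set.Ioo (0 : ℝ) a ×ˢ (ball x₀ (2 ^ (k + 1) * r) \ ball x₀ (2 ^ k * r)), Uₑ p * Gₑ p ≤
      γ ^ (1 / 2 : ℝ) * L₁ * ENNReal.ofReal (CK * Real.sqrt a * Real.sqrt V₁ * 4 ^ d / ρ * 2) := by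
    refine (ENNReal.tsum_le_tsum hshell).trans ?_
    rw [ENNReal.tsum_mul_left]
    gcongr
    rw [← ENNReal.ofReal_tsum_of_nonneg (fun k => by positivity) (summable_geometric_two.mul_left _),
      tsum_mul_left, tsum_geometric_two]
  have hcover := prod_univ_subset_union_iUnion_shell (Set.Ioo (0 : ℝ) a) x₀ hr0
  calc ∫⁻ p in Set.Ioo (0 : ℝ) a ×ˢ (Set.univ : Set E), Uₑ p * Gₑ p
      ≤ ∫⁻ p in Set.Ioo (0 : ℝ) a ×ˢ ball x₀ r ∪
          ⋃ k : ℕ, Set.Ioo (0 : ℝ) a ×ˢ (ball x₀ (2 ^ (k + 1) * r) \ ball x₀ (2 ^ k * r)), Uₑ p * Gₑ p :=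
        lintegral_mono_set hcover
    _ ≤ (∫⁻ p in Set.Ioo (0 : ℝ) a ×ˢ ball x₀ r, Uₑ p * Gₑ p) +
          ∫⁻ p in ⋃ k : ℕ, Set.Ioo (0 : ℝ) a ×ˢ (ball x₀ (2 ^ (k + 1) * r) \ ball x₀ (2 ^ k * r)), Uₑ p * Gₑ p :=
        lintegral_union_le _ _ _
    _ ≤ (∫⁻ p in Set.Ioo (0 : ℝ) a ×ˢ ball x₀ r, Uₑ p ^ 2) ^ (1 / 2 : ℝ) * L₂ +
          ∑' k : ℕ, ∫⁻ p in Set.Ioo (0 : ℝ) a ×ˢ (ball x₀ (2 ^ (k + 1) * r) \ ball x₀ (2 ^ k * r)), Uₑ p * Gₑ p :=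
        add_le_add htent (lintegral_iUnion_le _ _)
    _ ≤ (∫⁻ p in Set.Ioo (0 : ℝ) a ×ˢ ball x₀ r, Uₑ p ^ 2) ^ (1 / 2 : ℝ) * L₂ +
          γ ^ (1 / 2 : ℝ) * (ENNReal.ofReal (Real.sqrt (V₁ * ρ ^ d)) * L₂) *
            ENNReal.ofReal (CK * Real.sqrt a * Real.sqrt V₁ * 4 ^ d / ρ * 2) := by
        gcongr
        exact hsum.trans (by gcongr)
    _ = ((∫⁻ p in Set.Ioo (0 : ℝ) a ×ˢ ball x₀ r, Uₑ p ^ 2) ^ (1 / 2 : ℝ) +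
          ENNReal.ofReal (2 * CK * V₁ * 4 ^ d * Real.sqrt a * Real.sqrt (ρ ^ d) / ρ) * γ ^ (1 / 2 : ℝ)) * L₂ := by
        rw [add_mul]
        congr 1
        have e1 : ENNReal.ofReal (Real.sqrt (V₁ * ρ ^ d)) * ENNReal.ofReal (CK * Real.sqrt a * Real.sqrt V₁ * 4 ^ d / ρ * 2) =
            ENNReal.ofReal (2 * CK * V₁ * 4 ^ d * Real.sqrt a * Real.sqrt (ρ ^ d) / ρ) := by
          rw [← ENNReal.ofReal_mul (Real.sqrt_nonneg _)]
          congr 1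
          rw [Real.sqrt_mul hV₁0]
          have : Real.sqrt V₁ * Real.sqrt V₁ = V₁ := Real.mul_self_sqrt hV₁0
          field_simp
          nlinarith [this]
        calc γ ^ (1 / 2 : ℝ) * (ENNReal.ofReal (Real.sqrt (V₁ * ρ ^ d)) * L₂) *
              ENNReal.ofReal (CK * Real.sqrt a * Real.sqrt V₁ * 4 ^ d / ρ * 2)
            = (ENNReal.ofReal (Real.sqrt (V₁ * ρ ^ d)) *
                ENNReal.ofReal (CK * Real.sqrt a * Real.sqrt V₁ * 4 ^ d / ρ * 2)) * γ ^ (1 / 2 : ℝ) * L₂ := by ring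
          _ = _ := by rw [e1]

end Total

end BMOInv

end Literature.Analysis.FunctionSpaces
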